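import Literature.Probability.RandomPlanarGeometry.HexSAWSurfaceWallRenewalSlackTwoClassification
import HarnessLib

/-!
# Slack four, four down steps: the four `D D D D U U U U` families (A7–A10)

Self-avoiding walk on the honeycomb lattice in its brick-wall frame (`Eight.adjE`: horizontal steps everywhere, a
vertical edge `(x, y)–(x, y+1)` iff `x + y` is even), in the half-plane `Y ≤ 0`.  An IRREDUCIBLE POSITIVE WALL BRIDGE
`ω ∈ ipwb n` with `v = visits n ω` surface visits has SLACK `n − 6v`; at slack four (`n = 6k + 4`, `v = k ≥ 2`) it has
`2 ≤ #down ≤ 4` down steps (`…IteratedGap`).  The two-down and three-down strata are classified and counted in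
`…SlackFourTwoDown`, `…SlackFourThreeDownFamilies`,
    `…SlackFourThreeDownLaw`; for FOUR down steps the vertical profile is one
of five Dyck words (`…SlackFourFourDown`: `DDDDUUUU`, `DDDUDUUU`, `DDDUUDUU`, `DDUDDUUU`,
    `DDUUDDUU`).  This module constructs
the blocks with the deepest profile `D D D D U U U U` (bottom row `−4`) explicitly: FOUR FAMILIES,
    each an affine nine-piece
table walk (`Tab.walk` of `…SlackTwoFamilies` §0: wall run, rows `−1, −2, −3`, bottom row `−4`, rows `−3, −2, −1`,
    final wall
run), and proves that they are irreducible positive wall bridges of length `6k + 4` with `k` visits,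
    four down steps and four
up steps at explicit affine times.  The companion module `…SlackFourFourDownFamiliesShallow` does the same for the six
families of the other four profiles; separation and counting follow in a successor module.

Families (run words; `R`/`L` = right/left unit steps, `D`/`U` = down/up; all parameters natural numbers):
* A7 `s4a k a i j d g` : `R^{2a+1} D L^{2i+1} D L^{2j+1} D L^{2a−2i−2j−3} D R^{2d} U R^{2k−1−2d} U L^{2g+1} U
    L^{2k−2a−2g−3} U R^{2k−2a−1}`,
  `i + j + 2 ≤ a ≤ d + i + j + 1`, `d + 1 ≤ k`, `g + a + 2 ≤ k` (three left runs down to column `2` on row `−3`) —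
  `k(k−1)(k−2)(k−3)(4k−1)/120` blocks (`3, 19, 69, 189, 434` for `k = 4, …, 8`);
* A8 `s4b k i j e g` : `R^{2k−1} D L^{2i+1} D L^{2j+1} D L^{2k−2i−2j−5} D R^{2k−2e−2g−4} U R^{2e+1} U R^{2g+1} U R U R`,
  `i + j + 3 ≤ k`, `g ≤ i`, `e + g ≤ i + j` (wall run of length `2k−1`, staircase exit) — `(k−2)(k−1)²k/12` blocks
  (`1, 6, 20, 50, 105, 196` for `k = 3, …, 8`);
* A9 `s4c k a i j e g` : `R^{2a+1} D L^{2a−1} D R^{2i+1} D R^{2j+1} D R^{2k−2i−2j−2e−4} U R^{2e+1} U L^{2g+1} U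
    L^{2k−2a−2g−3} U R^{2k−2a−1}`,
  `1 ≤ a`, `i + j + e + 3 ≤ k`, `g + i + 2 ≤ k`, `g + a + 2 ≤ k` (hairpin opening, staircase descent) —
  `k(k−1)(k−2)(9k²−23k+8)/120` blocks (`1, 12, 59, 194, 504, 1120` for `k = 3, …, 8`);
* A10 `s4d k i j e g` : `R^{2k−1} D L^{2k−3} D R^{2i+1} D R^{2j+1} D R^{2k−2i−2j−2e−2g−6} U R^{2e+1} U R^{2g+1} U R U
    R`,
  `i + j + e + g + 4 ≤ k` — `C(k,4)` blocks (`1, 5, 15, 35, 70` for `k = 4, …, 8`).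
All four have span `X = 2k + 2` and resurface at column `p + 2` where `p` is the length of the initial wall run
(the labels are those of the lane's family catalogue).

Main statements (namespace `…SAW.HexBW.Wall`; `m = 6k + 4` symbolic throughout): per family `F ∈ {s4a, s4b, s4c, s4d}`
the tables `FX`, `FY`, the walk `F`, `F_facts` (`Tab.Facts`), `F_mem_pwb`, `F_apply`,
    ★ `F_mem_ipwb` (irreducibility by explicit
witnesses), ★ `visits_F = k`, ★ `stepsD_F = {d₁, d₂, d₃, d₄}` and `stepsU_F = {u₁, u₂, u₃,
    u₄}` (explicit affine times, listed
increasingly).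

PROOFS.  Every statement is linear arithmetic over the affine pieces of the tables (`F_cases`,
    by `split_ifs`): adjacency
through `Eight.adjE`, self-avoidance = same-row interval disjointness,
    irreducibility through `mem_ipwb_of_facts_wit` (each
interior visit of the initial wall run is followed by the body's leftmost column `2`,
    each interior visit of the final wall
run — there are none when `p = 2k − 1` — is preceded by the bottom exit column `2k + 1`),
    visits through `visits_add_of_wall` /
`visits_add_eq_left`, the vertical steps read off the tables.

STATUS: lane theorem of the a-idea-1 bridge/renewal lineage (successor of car 85 `…SlackFourThreeDownFamilies`); car
    95-A
«slack four: four down families, deep profile».  OURS (new in writing,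
    modest): the four explicit families.  CHECKED against
the lane's complete enumeration of the irreducible positive wall bridges of length `6k + 4` with `k` visits for `k
    = 2, …, 8`:
together with the six families of `…SlackFourFourDownFamiliesShallow` the ten families are pairwise disjoint,
    injectively
parametrised, and their union is EXACTLY the four-down stratum (`0, 3, 27, 129, 424, 1105, 2463` blocks for `k = 2,
    …, 8`;
no duplicate, no omission; the `D D D D U U U U` part is `0, 2, 22, 103, 328, 833, 1820`),
    in accordance with the recorded
four-down law `12·#{#stepsD = 4} = (k−2)(2k⁴ − 7k³ + 4k² + 7k + 6)` (computed, `k ≤ 15`).  The printed sources carry the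
renewal / irreducible-bridge structure (Madras–Slade §4.2, Definition 4.2.1, (4.2.2); Definition 1.2.4; Kesten),
    the brickwork
frame of the honeycomb lattice (Enting–Jensen §7.4.2,
    Fig. 7.10) and the surface-visit statistic (Beaton et al. §3.1) — none
lists these families.  No `set_option` line is used.
-/

namespace Literature.Probability.RandomPlanarGeometry.SAW.HexBW.Wall

open Finset Filter Function
open Literature.Probability.LatticeModels Literature.Probability.Percolation SimpleGraph

variable {n : ℕ} {ω : ℕ → Site 2}

/-! ### §0  Private tools -/

/-- The Boolean adjacency test `Eight.adjE` read as a proposition. [folklore] -/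
private theorem adjE_iff_fd {a b c d : ℤ} : Eight.adjE a b c d = true ↔
    ((c = a + 1 ∨ a = c + 1) ∧ d = b) ∨ (c = a ∧ ((d = b + 1 ∧ (a + b) % 2 = 0) ∨ (b = d + 1 ∧ (c + d) % 2 = 0))) := by
  simp [Eight.adjE]

/-! ### §1  Family A7 (`D D D D U U U U`, three left runs down to column `2` on row `−3`,
    bottom row `−4`): `R^{2a+1} D L^{2i+1} D L^{2j+1} D L^{2a−2i−2j−3} D R^{2d} U R^{2k−1−2d} U L^{2g+1} U
    L^{2k−2a−2g−3} U R^{2k−2a−1}` -/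

/-- Column table of the s4a blocks (length `6k + 4`, vertical profile `D D D D U U U U`),
    9 affine pieces on the rows `0, −1, −2, −3, −4, −3, −2, −1, 0` (values `(t : ℤ)`, `-(t : ℤ) + 4 * a + 3`,
    `-(t : ℤ) + 4 * a + 4`, `-(t : ℤ) + 4 * a + 5`, `(t : ℤ) - 4 * a - 2`, `(t : ℤ) - 4 * a - 3`, `-(t : ℤ) + 4 * k
    + 4 * a + 6`, `-(t : ℤ) + 4 * k + 4 * a + 7`,
    `(t : ℤ) - 4 * k - 2` on the successive pieces). [cite: EntingJensen2009, §7.4.2,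
    Fig. 7.10 (brickwork form of the honeycomb lattice)] -/
def s4aX (k a i j d g t : ℕ) : ℤ :=
  if t ≤ 2 * a + 1 then (t : ℤ)
  else if t ≤ 2 * a + 2 * i + 3 then -(t : ℤ) + 4 * a + 3
  else if t ≤ 2 * a + 2 * i + 2 * j + 5 then -(t : ℤ) + 4 * a + 4
  else if t ≤ 4 * a + 3 then -(t : ℤ) + 4 * a + 5
  else if t ≤ 4 * a + 2 * d + 4 then (t : ℤ) - 4 * a - 2
  else if t ≤ 2 * k + 4 * a + 4 then (t : ℤ) - 4 * a - 3
  else if t ≤ 2 * k + 4 * a + 2 * g + 6 then -(t : ℤ) + 4 * k + 4 * a + 6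
  else if t ≤ 4 * k + 2 * a + 4 then -(t : ℤ) + 4 * k + 4 * a + 7
  else (t : ℤ) - 4 * k - 2

/-- Height table of the s4a blocks: `0, −1, −2, −3, −4, −3, −2, −1, 0` on the 9 pieces. [cite: EntingJensen2009,
    §7.4.2, Fig. 7.10] -/
def s4aY (k a i j d g t : ℕ) : ℤ :=
  if t ≤ 2 * a + 1 then 0
  else if t ≤ 2 * a + 2 * i + 3 then -1
  else if t ≤ 2 * a + 2 * i + 2 * j + 5 then -2
  else if t ≤ 4 * a + 3 then -3
  else if t ≤ 4 * a + 2 * d + 4 then -4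
  else if t ≤ 2 * k + 4 * a + 4 then -3
  else if t ≤ 2 * k + 4 * a + 2 * g + 6 then -2
  else if t ≤ 4 * k + 2 * a + 4 then -1
  else 0

/-- **The A7 block**
    `(0,0)→…→(2a+1,0)↓←…↓←…↓←…←(2,−3)↓(2,−4)→…→(2d+2,−4)↑→…→(2k+1,−3)↑←…↑←…←(2a+3,−1)↑(2a+3,0)→…→(2k+2,0)` of length
    `6k+4`. [cite: EntingJensen2009, §7.4.2, Fig. 7.10] -/
def s4a (k a i j d g : ℕ) : ℕ → Site 2 := Tab.walk (6 * k + 4) (s4aX k a i j d g) (s4aY k a i j d g)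

/-- The affine pieces of the tables of `s4a`, with their values. [cite: EntingJensen2009, §7.4.2, Fig. 7.10] -/
private theorem s4a_cases (k a i j d g t : ℕ) :
    (t ≤ 2 * a + 1 ∧ s4aX k a i j d g t = (t : ℤ) ∧ s4aY k a i j d g t = 0) ∨
      (2 * a + 2 ≤ t ∧ t ≤ 2 * a + 2 * i + 3 ∧ s4aX k a i j d g t = -(t : ℤ) + 4 * a + 3 ∧ s4aY k a i j d g t = -1) ∨
      (2 * a + 2 * i + 4 ≤ t ∧ t ≤ 2 * a + 2 * i + 2 * j + 5 ∧ s4aX k a i j d g t = -(t : ℤ) + 4 * a + 4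
          ∧ s4aY k a i j d g t = -2) ∨
      (2 * a + 2 * i + 2 * j + 6 ≤ t ∧ t ≤ 4 * a + 3 ∧ s4aX k a i j d g t = -(t : ℤ) + 4 * a + 5
          ∧ s4aY k a i j d g t = -3) ∨
      (4 * a + 4 ≤ t ∧ t ≤ 4 * a + 2 * d + 4 ∧ s4aX k a i j d g t = (t : ℤ) - 4 * a - 2 ∧ s4aY k a i j d g t = -4) ∨
      (4 * a + 2 * d + 5 ≤ t ∧ t ≤ 2 * k + 4 * a + 4 ∧ s4aX k a i j d g t = (t : ℤ) - 4 * a - 3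
          ∧ s4aY k a i j d g t = -3) ∨
      (2 * k + 4 * a + 5 ≤ t ∧ t ≤ 2 * k + 4 * a + 2 * g + 6 ∧ s4aX k a i j d g t = -(t : ℤ) + 4 * k + 4 * a + 6
          ∧ s4aY k a i j d g t = -2) ∨
      (2 * k + 4 * a + 2 * g + 7 ≤ t ∧ t ≤ 4 * k + 2 * a + 4 ∧ s4aX k a i j d g t = -(t : ℤ) + 4 * k + 4 * a + 7
          ∧ s4aY k a i j d g t = -1) ∨
      (4 * k + 2 * a + 5 ≤ t ∧ s4aX k a i j d g t = (t : ℤ) - 4 * k - 2 ∧ s4aY k a i j d g t = 0) := by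
  simp only [s4aX, s4aY]
  split_ifs
  · exact Or.inl ⟨by omega, by omega, by omega⟩
  · exact Or.inr (Or.inl ⟨by omega, by omega, by omega, by omega⟩)
  · exact Or.inr (Or.inr (Or.inl ⟨by omega, by omega, by omega, by omega⟩))
  · exact Or.inr (Or.inr (Or.inr (Or.inl ⟨by omega, by omega, by omega, by omega⟩)))
  · exact Or.inr (Or.inr (Or.inr (Or.inr (Or.inl ⟨by omega, by omega, by omega, by omega⟩))))
  · exact Or.inr (Or.inr (Or.inr (Or.inr (Or.inr (Or.inl ⟨by omega, by omega, by omega, by omega⟩)))))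
  · exact Or.inr (Or.inr (Or.inr (Or.inr (Or.inr (Or.inr (Or.inl ⟨by omega, by omega, by omega, by omega⟩))))))
  · exact Or.inr (Or.inr (Or.inr (Or.inr (Or.inr (Or.inr (Or.inr (Or.inl ⟨by omega, by omega, by omega, by omega⟩)))))))
  · exact Or.inr (Or.inr (Or.inr (Or.inr (Or.inr (Or.inr (Or.inr (Or.inr (⟨by omega, by omega, by omega⟩))))))))

/-- **Coordinate facts of `s4a`** (`i + j + 2 ≤ a`, `a ≤ i + j + d + 1`, `d + 1 ≤ k`, `a + g + 2
    ≤ k`): brick-wall steps, self-avoidance, lower half-plane, columns in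
`[0, X_L]` and `≥ 1` after time `0`, start and end on the wall, even length. [cite: EntingJensen2009, §7.4.2, Fig. 7.10]
[cite: MadrasSlade1993, §1.2, Definition 1.2.4 (bridges, p. 11)] -/
theorem s4a_facts {k a i j d g : ℕ} (hij : i + j + 2 ≤ a) (hda : a ≤ i + j + d + 1) (hdk : d + 1 ≤ k) (hga : a + g
    + 2 ≤ k) : Tab.Facts (6 * k + 4) (s4aX k a i j d g) (s4aY k a i j d g) := by
  refine ⟨fun t ht => ?_, fun t ht s hs hx hy => ?_, fun t ht => ?_, fun t ht => ?_, ?_, ?_, ?_, by omega,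
      fun t ht h1 => ?_⟩
  · rw [adjE_iff_fd]
    rcases s4a_cases k a i j d g t with ⟨h, x, y⟩ | ⟨l, h, x, y⟩ | ⟨l, h, x, y⟩ | ⟨l, h, x, y⟩ | ⟨l, h, x, y⟩ | ⟨l,
        h, x, y⟩ | ⟨l, h, x, y⟩ | ⟨l, h, x, y⟩ | ⟨l, x, y⟩ <;>
      rcases s4a_cases k a i j d g (t + 1) with ⟨h', x', y'⟩ | ⟨l', h', x', y'⟩ | ⟨l', h', x', y'⟩ | ⟨l', h', x',
          y'⟩ | ⟨l', h', x', y'⟩ | ⟨l', h', x', y'⟩ | ⟨l', h', x', y'⟩ | ⟨l', h', x', y'⟩ | ⟨l', x', y'⟩ <;>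
        omega
  · rcases s4a_cases k a i j d g t with ⟨h, x, y⟩ | ⟨l, h, x, y⟩ | ⟨l, h, x, y⟩ | ⟨l, h, x, y⟩ | ⟨l, h, x, y⟩ | ⟨l,
      h, x, y⟩ | ⟨l, h, x, y⟩ | ⟨l, h, x, y⟩ | ⟨l, x, y⟩ <;>
      rcases s4a_cases k a i j d g s with ⟨h', x', y'⟩ | ⟨l', h', x', y'⟩ | ⟨l', h', x', y'⟩ | ⟨l', h', x',
          y'⟩ | ⟨l', h', x', y'⟩ | ⟨l', h', x', y'⟩ | ⟨l', h', x', y'⟩ | ⟨l', h', x', y'⟩ | ⟨l', x', y'⟩ <;>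
        omega
  · rcases s4a_cases k a i j d g t with ⟨h, x, y⟩ | ⟨l, h, x, y⟩ | ⟨l, h, x, y⟩ | ⟨l, h, x, y⟩ | ⟨l, h, x, y⟩ | ⟨l,
      h, x, y⟩ | ⟨l, h, x, y⟩ | ⟨l, h, x, y⟩ | ⟨l, x, y⟩ <;> omega
  · have h0 := s4a_cases k a i j d g 0
    have hL := s4a_cases k a i j d g (6 * k + 4)
    rcases s4a_cases k a i j d g t with ⟨h, x, y⟩ | ⟨l, h, x, y⟩ | ⟨l, h, x, y⟩ | ⟨l, h, x, y⟩ | ⟨l, h, x, y⟩ | ⟨l,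
        h, x, y⟩ | ⟨l, h, x, y⟩ | ⟨l, h, x, y⟩ | ⟨l, x, y⟩ <;> omega
  · have h0 := s4a_cases k a i j d g 0; omega
  · have h0 := s4a_cases k a i j d g 0; omega
  · have hL := s4a_cases k a i j d g (6 * k + 4); omega
  · rcases s4a_cases k a i j d g t with ⟨h, x, y⟩ | ⟨l, h, x, y⟩ | ⟨l, h, x, y⟩ | ⟨l, h, x, y⟩ | ⟨l, h, x, y⟩ | ⟨l,
      h, x, y⟩ | ⟨l, h, x, y⟩ | ⟨l, h, x, y⟩ | ⟨l, x, y⟩ <;> omega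

/-- `s4a` is a positive wall bridge of length `m = 6k + 4` (length symbolic). [cite: MadrasSlade1993, §1.2,
    Definition 1.2.4 (p. 11)]
[cite: EntingJensen2009, §7.4.2, Fig. 7.10] -/
theorem s4a_mem_pwb {k a i j d g m : ℕ} (hij : i + j + 2 ≤ a) (hda : a ≤ i + j + d + 1) (hdk : d + 1 ≤ k) (hga : a
    + g + 2 ≤ k) (hm : m = 6 * k + 4) : s4a k a i j d g ∈ pwb m :=
  mem_pwb_of_facts rfl (s4a_facts hij hda hdk hga) hm

/-- Coordinates of `s4a` up to its length. [cite: EntingJensen2009, §7.4.2, Fig. 7.10] -/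
theorem s4a_apply {k a i j d g t : ℕ} (ht : t ≤ 6 * k + 4) : s4a k a i j d g t 0 = s4aX k a i j d g t
    ∧ s4a k a i j d g t 1 = s4aY k a i j d g t :=
  tab_walk_apply ht

/-- **`s4a` is irreducible**: the interior visits of the initial wall run are followed by the body's leftmost column
    `2` (row `−3`),
    those of the final wall run (columns `≤ 2k`) are preceded by the bottom exit column `2k+1` (row `−3`). [cite:
    MadrasSlade1993, §4.2, Definition 4.2.1 (p. 90)]
[cite: Kesten1963SAW, §4] [cite: EntingJensen2009, §7.4.2, Fig. 7.10] -/
theorem s4a_mem_ipwb {k a i j d g m : ℕ} (hij : i + j + 2 ≤ a) (hda : a ≤ i + j + d + 1) (hdk : d + 1 ≤ k) (hga : a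
    + g + 2 ≤ k) (hm : m = 6 * k + 4) : s4a k a i j d g ∈ ipwb m := by
  refine mem_ipwb_of_facts_wit rfl (s4a_facts hij hda hdk hga) hm (by omega) fun t ht1 ht2 hte hY => ?_
  rcases s4a_cases k a i j d g t with ⟨h, x, y⟩ | ⟨l, h, x, y⟩ | ⟨l, h, x, y⟩ | ⟨l, h, x, y⟩ | ⟨l, h, x, y⟩ | ⟨l, h,
      x, y⟩ | ⟨l, h, x, y⟩ | ⟨l, h, x, y⟩ | ⟨l, x, y⟩
  · refine Or.inl ⟨4 * a + 3, by omega, by omega, ?_⟩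
    rcases s4a_cases k a i j d g (4 * a + 3) with ⟨h', x', y'⟩ | ⟨l', h', x', y'⟩ | ⟨l', h', x', y'⟩ | ⟨l', h', x',
        y'⟩ | ⟨l', h', x', y'⟩ | ⟨l', h', x', y'⟩ | ⟨l', h', x', y'⟩ | ⟨l', h', x', y'⟩ | ⟨l', x', y'⟩ <;>
      omega
  · omega
  · omega
  · omega
  · omega
  · omega
  · omega
  · omega
  · refine Or.inr ⟨2 * k + 4 * a + 4, by omega, by omega, ?_⟩
    rcases s4a_cases k a i j d g (2 * k + 4 * a + 4) with ⟨h', x', y'⟩ | ⟨l', h', x', y'⟩ | ⟨l', h', x', y'⟩ | ⟨l',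
        h', x', y'⟩ | ⟨l', h', x', y'⟩ | ⟨l', h', x', y'⟩ | ⟨l', h', x', y'⟩ | ⟨l', h', x', y'⟩ | ⟨l', x', y'⟩ <;>
      omega

/-- **`s4a` has `k` visits** (`a` on the initial wall run, `k − a` on the final one).
[cite: BeatonBousquetMelouDeGierDuminilCopinGuttmann2014, §3.1 (arXiv v5 p. 8)] [cite: EntingJensen2009, §7.4.2,
    Fig. 7.10] -/
theorem visits_s4a {k a i j d g m : ℕ} (hij : i + j + 2 ≤ a) (hda : a ≤ i + j + d + 1) (hdk : d + 1 ≤ k) (hga : a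
    + g + 2 ≤ k) (hm : m = 6 * k + 4) : visits m (s4a k a i j d g) = k := by
  have hY : ∀ t, t ≤ 6 * k + 4 → s4a k a i j d g t 1 = s4aY k a i j d g t := fun t ht => (s4a_apply ht).2
  have h1 : visits (0 + (2 * a + 1)) (s4a k a i j d g) = visits (0) (s4a k a i j d g) + ((0 + (2 * a
      + 1)) / 2 - (0) / 2) :=
    visits_add_of_wall fun q _ hq => by
      rw [hY _ (by omega)]
      rcases s4a_cases k a i j d g (0 + q) with ⟨h', x', y'⟩ | ⟨l', h', x', y'⟩ | ⟨l', h', x', y'⟩ | ⟨l', h', x',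
          y'⟩ | ⟨l', h', x', y'⟩ | ⟨l', h', x', y'⟩ | ⟨l', h', x', y'⟩ | ⟨l', h', x', y'⟩ | ⟨l', x', y'⟩ <;>
        omega
  have h2 : visits (2 * a + 1 + (4 * k + 3)) (s4a k a i j d g) = visits (2 * a + 1) (s4a k a i j d g) :=
    visits_add_eq_left fun q hq1 hq2 h => by
      obtain ⟨-, h0⟩ := h
      rw [hY _ (by omega)] at h0
      rcases s4a_cases k a i j d g (2 * a + 1 + q) with ⟨h', x', y'⟩ | ⟨l', h', x', y'⟩ | ⟨l', h', x', y'⟩ | ⟨l', h',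
          x', y'⟩ | ⟨l', h', x', y'⟩ | ⟨l', h', x', y'⟩ | ⟨l', h', x', y'⟩ | ⟨l', h', x', y'⟩ | ⟨l', x', y'⟩ <;> omega
  have h3 : visits (4 * k + 2 * a + 4 + (2 * k - 2 * a)) (s4a k a i j d g) = visits (4 * k + 2 * a
      + 4) (s4a k a i j d g) + ((4 * k + 2 * a + 4 + (2 * k - 2 * a)) / 2 - (4 * k + 2 * a + 4) / 2) :=
    visits_add_of_wall fun q _ hq => by
      rw [hY _ (by omega)]
      rcases s4a_cases k a i j d g (4 * k + 2 * a + 4 + q) with ⟨h', x', y'⟩ | ⟨l', h', x', y'⟩ | ⟨l', h', x',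
          y'⟩ | ⟨l', h', x', y'⟩ | ⟨l', h', x', y'⟩ | ⟨l', h', x', y'⟩ | ⟨l', h', x', y'⟩ | ⟨l', h', x', y'⟩ | ⟨l',
          x', y'⟩ <;>
        omega
  rw [zero_add, visits_zero, zero_add] at h1
  rw [show 2 * a + 1 + (4 * k + 3) = 4 * k + 2 * a + 4 by omega, h1] at h2
  rw [show 4 * k + 2 * a + 4 + (2 * k - 2 * a) = 6 * k + 4 by omega, h2] at h3
  subst hm
  rw [h3]
  omega

/-- **`s4a` has four down steps**, at the times `2 * a + 1`, `2 * a + 2 * i + 3`, `2 * a + 2 * i + 2 * j + 5`,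
    `4 * a + 3`. [cite: EntingJensen2009, §7.4.2, Fig. 7.10] -/
theorem stepsD_s4a {k a i j d g m : ℕ} (hij : i + j + 2 ≤ a) (hda : a ≤ i + j + d + 1) (hdk : d + 1 ≤ k) (hga : a
    + g + 2 ≤ k) (hm : m = 6 * k + 4) :
    stepsD m (s4a k a i j d g) = {2 * a + 1, 2 * a + 2 * i + 3, 2 * a + 2 * i + 2 * j + 5, 4 * a + 3} := by
  subst hm
  ext t
  simp only [stepsD, mem_filter, mem_range, mem_insert, mem_singleton]
  constructor
  · rintro ⟨ht, hx, hy⟩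
    rw [(s4a_apply (t := t + 1) (by omega)).1, (s4a_apply (t := t) (by omega)).1] at hx
    rw [(s4a_apply (t := t + 1) (by omega)).2, (s4a_apply (t := t) (by omega)).2] at hy
    rcases s4a_cases k a i j d g t with ⟨h, x, y⟩ | ⟨l, h, x, y⟩ | ⟨l, h, x, y⟩ | ⟨l, h, x, y⟩ | ⟨l, h, x, y⟩ | ⟨l,
        h, x, y⟩ | ⟨l, h, x, y⟩ | ⟨l, h, x, y⟩ | ⟨l, x, y⟩ <;>
      rcases s4a_cases k a i j d g (t + 1) with ⟨h', x', y'⟩ | ⟨l', h', x', y'⟩ | ⟨l', h', x', y'⟩ | ⟨l', h', x',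
          y'⟩ | ⟨l', h', x', y'⟩ | ⟨l', h', x', y'⟩ | ⟨l', h', x', y'⟩ | ⟨l', h', x', y'⟩ | ⟨l', x', y'⟩ <;>
        omega
  · intro ht
    have ht4 : t + 1 ≤ 6 * k + 4 := by omega
    refine ⟨by omega, ?_, ?_⟩
    · rw [(s4a_apply ht4).1, (s4a_apply (t := t) (by omega)).1]
      rcases s4a_cases k a i j d g t with ⟨h, x, y⟩ | ⟨l, h, x, y⟩ | ⟨l, h, x, y⟩ | ⟨l, h, x, y⟩ | ⟨l, h, x, y⟩ | ⟨l,
          h, x, y⟩ | ⟨l, h, x, y⟩ | ⟨l, h, x, y⟩ | ⟨l, x, y⟩ <;>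
        rcases s4a_cases k a i j d g (t + 1) with ⟨h', x', y'⟩ | ⟨l', h', x', y'⟩ | ⟨l', h', x', y'⟩ | ⟨l', h', x',
            y'⟩ | ⟨l', h', x', y'⟩ | ⟨l', h', x', y'⟩ | ⟨l', h', x', y'⟩ | ⟨l', h', x', y'⟩ | ⟨l', x', y'⟩ <;>
          omega
    · rw [(s4a_apply ht4).2, (s4a_apply (t := t) (by omega)).2]
      rcases s4a_cases k a i j d g t with ⟨h, x, y⟩ | ⟨l, h, x, y⟩ | ⟨l, h, x, y⟩ | ⟨l, h, x, y⟩ | ⟨l, h, x, y⟩ | ⟨l,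
          h, x, y⟩ | ⟨l, h, x, y⟩ | ⟨l, h, x, y⟩ | ⟨l, x, y⟩ <;>
        rcases s4a_cases k a i j d g (t + 1) with ⟨h', x', y'⟩ | ⟨l', h', x', y'⟩ | ⟨l', h', x', y'⟩ | ⟨l', h', x',
            y'⟩ | ⟨l', h', x', y'⟩ | ⟨l', h', x', y'⟩ | ⟨l', h', x', y'⟩ | ⟨l', h', x', y'⟩ | ⟨l', x', y'⟩ <;>
          omega

/-- **`s4a` has four up steps**, at the times `4 * a + 2 * d + 4`, `2 * k + 4 * a + 4`, `2 * k + 4 * a + 2 * g + 6`,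
    `4 * k + 2 * a + 4`. [cite: EntingJensen2009, §7.4.2, Fig. 7.10] -/
theorem stepsU_s4a {k a i j d g m : ℕ} (hij : i + j + 2 ≤ a) (hda : a ≤ i + j + d + 1) (hdk : d + 1 ≤ k) (hga : a
    + g + 2 ≤ k) (hm : m = 6 * k + 4) :
    stepsU m (s4a k a i j d g) = {4 * a + 2 * d + 4, 2 * k + 4 * a + 4, 2 * k + 4 * a + 2 * g + 6, 4 * k + 2 * a
        + 4} := by
  subst hm
  ext t
  simp only [stepsU, mem_filter, mem_range, mem_insert, mem_singleton]
  constructor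
  · rintro ⟨ht, hx, hy⟩
    rw [(s4a_apply (t := t + 1) (by omega)).1, (s4a_apply (t := t) (by omega)).1] at hx
    rw [(s4a_apply (t := t + 1) (by omega)).2, (s4a_apply (t := t) (by omega)).2] at hy
    rcases s4a_cases k a i j d g t with ⟨h, x, y⟩ | ⟨l, h, x, y⟩ | ⟨l, h, x, y⟩ | ⟨l, h, x, y⟩ | ⟨l, h, x, y⟩ | ⟨l,
        h, x, y⟩ | ⟨l, h, x, y⟩ | ⟨l, h, x, y⟩ | ⟨l, x, y⟩ <;>
      rcases s4a_cases k a i j d g (t + 1) with ⟨h', x', y'⟩ | ⟨l', h', x', y'⟩ | ⟨l', h', x', y'⟩ | ⟨l', h', x',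
          y'⟩ | ⟨l', h', x', y'⟩ | ⟨l', h', x', y'⟩ | ⟨l', h', x', y'⟩ | ⟨l', h', x', y'⟩ | ⟨l', x', y'⟩ <;>
        omega
  · intro ht
    have ht4 : t + 1 ≤ 6 * k + 4 := by omega
    refine ⟨by omega, ?_, ?_⟩
    · rw [(s4a_apply ht4).1, (s4a_apply (t := t) (by omega)).1]
      rcases s4a_cases k a i j d g t with ⟨h, x, y⟩ | ⟨l, h, x, y⟩ | ⟨l, h, x, y⟩ | ⟨l, h, x, y⟩ | ⟨l, h, x, y⟩ | ⟨l,
          h, x, y⟩ | ⟨l, h, x, y⟩ | ⟨l, h, x, y⟩ | ⟨l, x, y⟩ <;>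
        rcases s4a_cases k a i j d g (t + 1) with ⟨h', x', y'⟩ | ⟨l', h', x', y'⟩ | ⟨l', h', x', y'⟩ | ⟨l', h', x',
            y'⟩ | ⟨l', h', x', y'⟩ | ⟨l', h', x', y'⟩ | ⟨l', h', x', y'⟩ | ⟨l', h', x', y'⟩ | ⟨l', x', y'⟩ <;>
          omega
    · rw [(s4a_apply ht4).2, (s4a_apply (t := t) (by omega)).2]
      rcases s4a_cases k a i j d g t with ⟨h, x, y⟩ | ⟨l, h, x, y⟩ | ⟨l, h, x, y⟩ | ⟨l, h, x, y⟩ | ⟨l, h, x, y⟩ | ⟨l,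
          h, x, y⟩ | ⟨l, h, x, y⟩ | ⟨l, h, x, y⟩ | ⟨l, x, y⟩ <;>
        rcases s4a_cases k a i j d g (t + 1) with ⟨h', x', y'⟩ | ⟨l', h', x', y'⟩ | ⟨l', h', x', y'⟩ | ⟨l', h', x',
            y'⟩ | ⟨l', h', x', y'⟩ | ⟨l', h', x', y'⟩ | ⟨l', h', x', y'⟩ | ⟨l', h', x', y'⟩ | ⟨l', x', y'⟩ <;>
          omega


/-! ### §2  Family A8 (`D D D D U U U U`, wall run of length `2k−1`, three left runs,
    staircase exit): `R^{2k−1} D L^{2i+1} D L^{2j+1} D L^{2k−2i−2j−5} D R^{2k−2e−2g−4} U R^{2e+1} U R^{2g+1} U R U R` -/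

/-- Column table of the s4b blocks (length `6k + 4`, vertical profile `D D D D U U U U`),
    9 affine pieces on the rows `0, −1, −2, −3, −4, −3, −2, −1, 0` (values `(t : ℤ)`, `-(t : ℤ) + 4 * k - 1`,
    `-(t : ℤ) + 4 * k`, `-(t : ℤ) + 4 * k + 1`, `(t : ℤ) - 4 * k + 2`, `(t : ℤ) - 4 * k + 1`, `(t : ℤ) - 4 * k`,
    `(t : ℤ) - 4 * k - 1`, `(t : ℤ) - 4 * k - 2` on the successive pieces). [cite: EntingJensen2009, §7.4.2,
    Fig. 7.10 (brickwork form of the honeycomb lattice)] -/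
def s4bX (k i j e g t : ℕ) : ℤ :=
  if t + 1 ≤ 2 * k then (t : ℤ)
  else if t ≤ 2 * k + 2 * i + 1 then -(t : ℤ) + 4 * k - 1
  else if t ≤ 2 * k + 2 * i + 2 * j + 3 then -(t : ℤ) + 4 * k
  else if t + 1 ≤ 4 * k then -(t : ℤ) + 4 * k + 1
  else if t + 2 * e + 2 * g + 4 ≤ 6 * k then (t : ℤ) - 4 * k + 2
  else if t + 2 * g + 2 ≤ 6 * k then (t : ℤ) - 4 * k + 1
  else if t ≤ 6 * k then (t : ℤ) - 4 * k
  else if t ≤ 6 * k + 2 then (t : ℤ) - 4 * k - 1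
  else (t : ℤ) - 4 * k - 2

/-- Height table of the s4b blocks: `0, −1, −2, −3, −4, −3, −2, −1, 0` on the 9 pieces. [cite: EntingJensen2009,
    §7.4.2, Fig. 7.10] -/
def s4bY (k i j e g t : ℕ) : ℤ :=
  if t + 1 ≤ 2 * k then 0
  else if t ≤ 2 * k + 2 * i + 1 then -1
  else if t ≤ 2 * k + 2 * i + 2 * j + 3 then -2
  else if t + 1 ≤ 4 * k then -3
  else if t + 2 * e + 2 * g + 4 ≤ 6 * k then -4
  else if t + 2 * g + 2 ≤ 6 * k then -3
  else if t ≤ 6 * k then -2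
  else if t ≤ 6 * k + 2 then -1
  else 0

/-- **The A8 block** `(0,0)→…→(2k−1,0)↓←…↓←…↓←…←(2,−3)↓(2,−4)→…↑→…↑→…→(2k,−2)↑(2k,−1)→(2k+1,−1)↑(2k+1,0)→(2k+2,0)` of
    length `6k+4`. [cite: EntingJensen2009, §7.4.2, Fig. 7.10] -/
def s4b (k i j e g : ℕ) : ℕ → Site 2 := Tab.walk (6 * k + 4) (s4bX k i j e g) (s4bY k i j e g)

/-- The affine pieces of the tables of `s4b`, with their values. [cite: EntingJensen2009, §7.4.2, Fig. 7.10] -/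
private theorem s4b_cases (k i j e g t : ℕ) :
    (t + 1 ≤ 2 * k ∧ s4bX k i j e g t = (t : ℤ) ∧ s4bY k i j e g t = 0) ∨
      (2 * k ≤ t ∧ t ≤ 2 * k + 2 * i + 1 ∧ s4bX k i j e g t = -(t : ℤ) + 4 * k - 1 ∧ s4bY k i j e g t = -1) ∨
      (2 * k + 2 * i + 2 ≤ t ∧ t ≤ 2 * k + 2 * i + 2 * j + 3 ∧ s4bX k i j e g t = -(t : ℤ) + 4 * k
          ∧ s4bY k i j e g t = -2) ∨
      (2 * k + 2 * i + 2 * j + 4 ≤ t ∧ t + 1 ≤ 4 * k ∧ s4bX k i j e g t = -(t : ℤ) + 4 * k + 1 ∧ s4bY k i j e g t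
          = -3) ∨
      (4 * k ≤ t ∧ t + 2 * e + 2 * g + 4 ≤ 6 * k ∧ s4bX k i j e g t = (t : ℤ) - 4 * k + 2 ∧ s4bY k i j e g t = -4) ∨
      (6 * k ≤ t + 2 * e + 2 * g + 3 ∧ t + 2 * g + 2 ≤ 6 * k ∧ s4bX k i j e g t = (t : ℤ) - 4 * k + 1
          ∧ s4bY k i j e g t = -3) ∨
      (6 * k ≤ t + 2 * g + 1 ∧ t ≤ 6 * k ∧ s4bX k i j e g t = (t : ℤ) - 4 * k ∧ s4bY k i j e g t = -2) ∨
      (6 * k + 1 ≤ t ∧ t ≤ 6 * k + 2 ∧ s4bX k i j e g t = (t : ℤ) - 4 * k - 1 ∧ s4bY k i j e g t = -1) ∨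
      (6 * k + 3 ≤ t ∧ s4bX k i j e g t = (t : ℤ) - 4 * k - 2 ∧ s4bY k i j e g t = 0) := by
  simp only [s4bX, s4bY]
  split_ifs
  · exact Or.inl ⟨by omega, by omega, by omega⟩
  · exact Or.inr (Or.inl ⟨by omega, by omega, by omega, by omega⟩)
  · exact Or.inr (Or.inr (Or.inl ⟨by omega, by omega, by omega, by omega⟩))
  · exact Or.inr (Or.inr (Or.inr (Or.inl ⟨by omega, by omega, by omega, by omega⟩)))
  · exact Or.inr (Or.inr (Or.inr (Or.inr (Or.inl ⟨by omega, by omega, by omega, by omega⟩))))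
  · exact Or.inr (Or.inr (Or.inr (Or.inr (Or.inr (Or.inl ⟨by omega, by omega, by omega, by omega⟩)))))
  · exact Or.inr (Or.inr (Or.inr (Or.inr (Or.inr (Or.inr (Or.inl ⟨by omega, by omega, by omega, by omega⟩))))))
  · exact Or.inr (Or.inr (Or.inr (Or.inr (Or.inr (Or.inr (Or.inr (Or.inl ⟨by omega, by omega, by omega, by omega⟩)))))))
  · exact Or.inr (Or.inr (Or.inr (Or.inr (Or.inr (Or.inr (Or.inr (Or.inr (⟨by omega, by omega, by omega⟩))))))))

/-- **Coordinate facts of `s4b`** (`i + j + 3 ≤ k`, `g ≤ i`, `e + g ≤ i + j`): brick-wall steps, self-avoidance,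
    lower half-plane, columns in
`[0, X_L]` and `≥ 1` after time `0`, start and end on the wall, even length. [cite: EntingJensen2009, §7.4.2, Fig. 7.10]
[cite: MadrasSlade1993, §1.2, Definition 1.2.4 (bridges, p. 11)] -/
theorem s4b_facts {k i j e g : ℕ} (hij : i + j + 3 ≤ k) (hgi : g ≤ i) (heg : e + g ≤ i + j) : Tab.Facts (6 * k
    + 4) (s4bX k i j e g) (s4bY k i j e g) := by
  refine ⟨fun t ht => ?_, fun t ht s hs hx hy => ?_, fun t ht => ?_, fun t ht => ?_, ?_, ?_, ?_, by omega,
      fun t ht h1 => ?_⟩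
  · rw [adjE_iff_fd]
    rcases s4b_cases k i j e g t with ⟨h, x, y⟩ | ⟨l, h, x, y⟩ | ⟨l, h, x, y⟩ | ⟨l, h, x, y⟩ | ⟨l, h, x, y⟩ | ⟨l, h,
        x, y⟩ | ⟨l, h, x, y⟩ | ⟨l, h, x, y⟩ | ⟨l, x, y⟩ <;>
      rcases s4b_cases k i j e g (t + 1) with ⟨h', x', y'⟩ | ⟨l', h', x', y'⟩ | ⟨l', h', x', y'⟩ | ⟨l', h', x',
          y'⟩ | ⟨l', h', x', y'⟩ | ⟨l', h', x', y'⟩ | ⟨l', h', x', y'⟩ | ⟨l', h', x', y'⟩ | ⟨l', x', y'⟩ <;>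
        omega
  · rcases s4b_cases k i j e g t with ⟨h, x, y⟩ | ⟨l, h, x, y⟩ | ⟨l, h, x, y⟩ | ⟨l, h, x, y⟩ | ⟨l, h, x, y⟩ | ⟨l, h,
      x, y⟩ | ⟨l, h, x, y⟩ | ⟨l, h, x, y⟩ | ⟨l, x, y⟩ <;>
      rcases s4b_cases k i j e g s with ⟨h', x', y'⟩ | ⟨l', h', x', y'⟩ | ⟨l', h', x', y'⟩ | ⟨l', h', x', y'⟩ | ⟨l',
          h', x', y'⟩ | ⟨l', h', x', y'⟩ | ⟨l', h', x', y'⟩ | ⟨l', h', x', y'⟩ | ⟨l', x', y'⟩ <;>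
        omega
  · rcases s4b_cases k i j e g t with ⟨h, x, y⟩ | ⟨l, h, x, y⟩ | ⟨l, h, x, y⟩ | ⟨l, h, x, y⟩ | ⟨l, h, x, y⟩ | ⟨l, h,
      x, y⟩ | ⟨l, h, x, y⟩ | ⟨l, h, x, y⟩ | ⟨l, x, y⟩ <;> omega
  · have h0 := s4b_cases k i j e g 0
    have hL := s4b_cases k i j e g (6 * k + 4)
    rcases s4b_cases k i j e g t with ⟨h, x, y⟩ | ⟨l, h, x, y⟩ | ⟨l, h, x, y⟩ | ⟨l, h, x, y⟩ | ⟨l, h, x, y⟩ | ⟨l, h,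
        x, y⟩ | ⟨l, h, x, y⟩ | ⟨l, h, x, y⟩ | ⟨l, x, y⟩ <;> omega
  · have h0 := s4b_cases k i j e g 0; omega
  · have h0 := s4b_cases k i j e g 0; omega
  · have hL := s4b_cases k i j e g (6 * k + 4); omega
  · rcases s4b_cases k i j e g t with ⟨h, x, y⟩ | ⟨l, h, x, y⟩ | ⟨l, h, x, y⟩ | ⟨l, h, x, y⟩ | ⟨l, h, x, y⟩ | ⟨l, h,
      x, y⟩ | ⟨l, h, x, y⟩ | ⟨l, h, x, y⟩ | ⟨l, x, y⟩ <;> omega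

/-- `s4b` is a positive wall bridge of length `m = 6k + 4` (length symbolic). [cite: MadrasSlade1993, §1.2,
    Definition 1.2.4 (p. 11)]
[cite: EntingJensen2009, §7.4.2, Fig. 7.10] -/
theorem s4b_mem_pwb {k i j e g m : ℕ} (hij : i + j + 3 ≤ k) (hgi : g ≤ i) (heg : e + g ≤ i + j) (hm : m = 6 * k
    + 4) : s4b k i j e g ∈ pwb m :=
  mem_pwb_of_facts rfl (s4b_facts hij hgi heg) hm

/-- Coordinates of `s4b` up to its length. [cite: EntingJensen2009, §7.4.2, Fig. 7.10] -/
theorem s4b_apply {k i j e g t : ℕ} (ht : t ≤ 6 * k + 4) : s4b k i j e g t 0 = s4bX k i j e g t ∧ s4b k i j e g t 1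
    = s4bY k i j e g t :=
  tab_walk_apply ht

/-- **`s4b` is irreducible**: the interior visits (all on the initial wall run) are followed by the body's leftmost
    column `2`; the final wall run is a single step. [cite: MadrasSlade1993, §4.2, Definition 4.2.1 (p. 90)]
[cite: Kesten1963SAW, §4] [cite: EntingJensen2009, §7.4.2, Fig. 7.10] -/
theorem s4b_mem_ipwb {k i j e g m : ℕ} (hij : i + j + 3 ≤ k) (hgi : g ≤ i) (heg : e + g ≤ i + j) (hm : m = 6 * k
    + 4) : s4b k i j e g ∈ ipwb m := by
  refine mem_ipwb_of_facts_wit rfl (s4b_facts hij hgi heg) hm (by omega) fun t ht1 ht2 hte hY => ?_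
  rcases s4b_cases k i j e g t with ⟨h, x, y⟩ | ⟨l, h, x, y⟩ | ⟨l, h, x, y⟩ | ⟨l, h, x, y⟩ | ⟨l, h, x, y⟩ | ⟨l, h, x,
      y⟩ | ⟨l, h, x, y⟩ | ⟨l, h, x, y⟩ | ⟨l, x, y⟩
  · refine Or.inl ⟨4 * k - 1, by omega, by omega, ?_⟩
    rcases s4b_cases k i j e g (4 * k - 1) with ⟨h', x', y'⟩ | ⟨l', h', x', y'⟩ | ⟨l', h', x', y'⟩ | ⟨l', h', x',
        y'⟩ | ⟨l', h', x', y'⟩ | ⟨l', h', x', y'⟩ | ⟨l', h', x', y'⟩ | ⟨l', h', x', y'⟩ | ⟨l', x', y'⟩ <;>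
      omega
  · omega
  · omega
  · omega
  · omega
  · omega
  · omega
  · omega
  · omega

/-- **`s4b` has `k` visits** (`k − 1` on the initial wall run and the endpoint).
[cite: BeatonBousquetMelouDeGierDuminilCopinGuttmann2014, §3.1 (arXiv v5 p. 8)] [cite: EntingJensen2009, §7.4.2,
    Fig. 7.10] -/
theorem visits_s4b {k i j e g m : ℕ} (hij : i + j + 3 ≤ k) (hgi : g ≤ i) (heg : e + g ≤ i + j) (hm : m = 6 * k
    + 4) : visits m (s4b k i j e g) = k := by
  have hY : ∀ t, t ≤ 6 * k + 4 → s4b k i j e g t 1 = s4bY k i j e g t := fun t ht => (s4b_apply ht).2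
  have h1 : visits (0 + (2 * k - 1)) (s4b k i j e g) = visits (0) (s4b k i j e g) + ((0 + (2 * k - 1)) / 2 - (0) / 2) :=
    visits_add_of_wall fun q _ hq => by
      rw [hY _ (by omega)]
      rcases s4b_cases k i j e g (0 + q) with ⟨h', x', y'⟩ | ⟨l', h', x', y'⟩ | ⟨l', h', x', y'⟩ | ⟨l', h', x',
          y'⟩ | ⟨l', h', x', y'⟩ | ⟨l', h', x', y'⟩ | ⟨l', h', x', y'⟩ | ⟨l', h', x', y'⟩ | ⟨l', x', y'⟩ <;>
        omega
  have h2 : visits (2 * k - 1 + (4 * k + 3)) (s4b k i j e g) = visits (2 * k - 1) (s4b k i j e g) :=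
    visits_add_eq_left fun q hq1 hq2 h => by
      obtain ⟨-, h0⟩ := h
      rw [hY _ (by omega)] at h0
      rcases s4b_cases k i j e g (2 * k - 1 + q) with ⟨h', x', y'⟩ | ⟨l', h', x', y'⟩ | ⟨l', h', x', y'⟩ | ⟨l', h',
          x', y'⟩ | ⟨l', h', x', y'⟩ | ⟨l', h', x', y'⟩ | ⟨l', h', x', y'⟩ | ⟨l', h', x', y'⟩ | ⟨l', x', y'⟩ <;> omega
  have h3 : visits (6 * k + 2 + (2)) (s4b k i j e g) = visits (6 * k + 2) (s4b k i j e g) + ((6 * k + 2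
      + (2)) / 2 - (6 * k + 2) / 2) :=
    visits_add_of_wall fun q _ hq => by
      rw [hY _ (by omega)]
      rcases s4b_cases k i j e g (6 * k + 2 + q) with ⟨h', x', y'⟩ | ⟨l', h', x', y'⟩ | ⟨l', h', x', y'⟩ | ⟨l', h',
          x', y'⟩ | ⟨l', h', x', y'⟩ | ⟨l', h', x', y'⟩ | ⟨l', h', x', y'⟩ | ⟨l', h', x', y'⟩ | ⟨l', x', y'⟩ <;>
        omega
  rw [zero_add, visits_zero, zero_add] at h1
  rw [show 2 * k - 1 + (4 * k + 3) = 6 * k + 2 by omega, h1] at h2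
  rw [show 6 * k + 2 + (2) = 6 * k + 4 by omega, h2] at h3
  subst hm
  rw [h3]
  omega

/-- **`s4b` has four down steps**, at the times `2 * k - 1`, `2 * k + 2 * i + 1`, `2 * k + 2 * i + 2 * j + 3`,
    `4 * k - 1`. [cite: EntingJensen2009, §7.4.2, Fig. 7.10] -/
theorem stepsD_s4b {k i j e g m : ℕ} (hij : i + j + 3 ≤ k) (hgi : g ≤ i) (heg : e + g ≤ i + j) (hm : m = 6 * k + 4) :
    stepsD m (s4b k i j e g) = {2 * k - 1, 2 * k + 2 * i + 1, 2 * k + 2 * i + 2 * j + 3, 4 * k - 1} := by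
  subst hm
  ext t
  simp only [stepsD, mem_filter, mem_range, mem_insert, mem_singleton]
  constructor
  · rintro ⟨ht, hx, hy⟩
    rw [(s4b_apply (t := t + 1) (by omega)).1, (s4b_apply (t := t) (by omega)).1] at hx
    rw [(s4b_apply (t := t + 1) (by omega)).2, (s4b_apply (t := t) (by omega)).2] at hy
    rcases s4b_cases k i j e g t with ⟨h, x, y⟩ | ⟨l, h, x, y⟩ | ⟨l, h, x, y⟩ | ⟨l, h, x, y⟩ | ⟨l, h, x, y⟩ | ⟨l, h,
        x, y⟩ | ⟨l, h, x, y⟩ | ⟨l, h, x, y⟩ | ⟨l, x, y⟩ <;>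
      rcases s4b_cases k i j e g (t + 1) with ⟨h', x', y'⟩ | ⟨l', h', x', y'⟩ | ⟨l', h', x', y'⟩ | ⟨l', h', x',
          y'⟩ | ⟨l', h', x', y'⟩ | ⟨l', h', x', y'⟩ | ⟨l', h', x', y'⟩ | ⟨l', h', x', y'⟩ | ⟨l', x', y'⟩ <;>
        omega
  · intro ht
    have ht4 : t + 1 ≤ 6 * k + 4 := by omega
    refine ⟨by omega, ?_, ?_⟩
    · rw [(s4b_apply ht4).1, (s4b_apply (t := t) (by omega)).1]
      rcases s4b_cases k i j e g t with ⟨h, x, y⟩ | ⟨l, h, x, y⟩ | ⟨l, h, x, y⟩ | ⟨l, h, x, y⟩ | ⟨l, h, x, y⟩ | ⟨l,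
          h, x, y⟩ | ⟨l, h, x, y⟩ | ⟨l, h, x, y⟩ | ⟨l, x, y⟩ <;>
        rcases s4b_cases k i j e g (t + 1) with ⟨h', x', y'⟩ | ⟨l', h', x', y'⟩ | ⟨l', h', x', y'⟩ | ⟨l', h', x',
            y'⟩ | ⟨l', h', x', y'⟩ | ⟨l', h', x', y'⟩ | ⟨l', h', x', y'⟩ | ⟨l', h', x', y'⟩ | ⟨l', x', y'⟩ <;>
          omega
    · rw [(s4b_apply ht4).2, (s4b_apply (t := t) (by omega)).2]
      rcases s4b_cases k i j e g t with ⟨h, x, y⟩ | ⟨l, h, x, y⟩ | ⟨l, h, x, y⟩ | ⟨l, h, x, y⟩ | ⟨l, h, x, y⟩ | ⟨l,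
          h, x, y⟩ | ⟨l, h, x, y⟩ | ⟨l, h, x, y⟩ | ⟨l, x, y⟩ <;>
        rcases s4b_cases k i j e g (t + 1) with ⟨h', x', y'⟩ | ⟨l', h', x', y'⟩ | ⟨l', h', x', y'⟩ | ⟨l', h', x',
            y'⟩ | ⟨l', h', x', y'⟩ | ⟨l', h', x', y'⟩ | ⟨l', h', x', y'⟩ | ⟨l', h', x', y'⟩ | ⟨l', x', y'⟩ <;>
          omega

/-- **`s4b` has four up steps**, at the times `6 * k - 2 * e - 2 * g - 4`, `6 * k - 2 * g - 2`, `6 * k`, `6 * k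
    + 2`. [cite: EntingJensen2009, §7.4.2, Fig. 7.10] -/
theorem stepsU_s4b {k i j e g m : ℕ} (hij : i + j + 3 ≤ k) (hgi : g ≤ i) (heg : e + g ≤ i + j) (hm : m = 6 * k + 4) :
    stepsU m (s4b k i j e g) = {6 * k - 2 * e - 2 * g - 4, 6 * k - 2 * g - 2, 6 * k, 6 * k + 2} := by
  subst hm
  ext t
  simp only [stepsU, mem_filter, mem_range, mem_insert, mem_singleton]
  constructor
  · rintro ⟨ht, hx, hy⟩
    rw [(s4b_apply (t := t + 1) (by omega)).1, (s4b_apply (t := t) (by omega)).1] at hx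
    rw [(s4b_apply (t := t + 1) (by omega)).2, (s4b_apply (t := t) (by omega)).2] at hy
    rcases s4b_cases k i j e g t with ⟨h, x, y⟩ | ⟨l, h, x, y⟩ | ⟨l, h, x, y⟩ | ⟨l, h, x, y⟩ | ⟨l, h, x, y⟩ | ⟨l, h,
        x, y⟩ | ⟨l, h, x, y⟩ | ⟨l, h, x, y⟩ | ⟨l, x, y⟩ <;>
      rcases s4b_cases k i j e g (t + 1) with ⟨h', x', y'⟩ | ⟨l', h', x', y'⟩ | ⟨l', h', x', y'⟩ | ⟨l', h', x',
          y'⟩ | ⟨l', h', x', y'⟩ | ⟨l', h', x', y'⟩ | ⟨l', h', x', y'⟩ | ⟨l', h', x', y'⟩ | ⟨l', x', y'⟩ <;>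
        omega
  · intro ht
    have ht4 : t + 1 ≤ 6 * k + 4 := by omega
    refine ⟨by omega, ?_, ?_⟩
    · rw [(s4b_apply ht4).1, (s4b_apply (t := t) (by omega)).1]
      rcases s4b_cases k i j e g t with ⟨h, x, y⟩ | ⟨l, h, x, y⟩ | ⟨l, h, x, y⟩ | ⟨l, h, x, y⟩ | ⟨l, h, x, y⟩ | ⟨l,
          h, x, y⟩ | ⟨l, h, x, y⟩ | ⟨l, h, x, y⟩ | ⟨l, x, y⟩ <;>
        rcases s4b_cases k i j e g (t + 1) with ⟨h', x', y'⟩ | ⟨l', h', x', y'⟩ | ⟨l', h', x', y'⟩ | ⟨l', h', x',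
            y'⟩ | ⟨l', h', x', y'⟩ | ⟨l', h', x', y'⟩ | ⟨l', h', x', y'⟩ | ⟨l', h', x', y'⟩ | ⟨l', x', y'⟩ <;>
          omega
    · rw [(s4b_apply ht4).2, (s4b_apply (t := t) (by omega)).2]
      rcases s4b_cases k i j e g t with ⟨h, x, y⟩ | ⟨l, h, x, y⟩ | ⟨l, h, x, y⟩ | ⟨l, h, x, y⟩ | ⟨l, h, x, y⟩ | ⟨l,
          h, x, y⟩ | ⟨l, h, x, y⟩ | ⟨l, h, x, y⟩ | ⟨l, x, y⟩ <;>
        rcases s4b_cases k i j e g (t + 1) with ⟨h', x', y'⟩ | ⟨l', h', x', y'⟩ | ⟨l', h', x', y'⟩ | ⟨l', h', x',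
            y'⟩ | ⟨l', h', x', y'⟩ | ⟨l', h', x', y'⟩ | ⟨l', h', x', y'⟩ | ⟨l', h', x', y'⟩ | ⟨l', x', y'⟩ <;>
          omega


/-! ### §3  Family A9 (`D D D D U U U U`, hairpin opening,
    staircase descent to row `−4`): `R^{2a+1} D L^{2a−1} D R^{2i+1} D R^{2j+1} D R^{2k−2i−2j−2e−4} U R^{2e+1} U
    L^{2g+1} U L^{2k−2a−2g−3} U R^{2k−2a−1}` -/

/-- Column table of the s4c blocks (length `6k + 4`, vertical profile `D D D D U U U U`),
    9 affine pieces on the rows `0, −1, −2, −3, −4, −3, −2, −1, 0` (values `(t : ℤ)`, `-(t : ℤ) + 4 * a + 3`,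
    `(t : ℤ) - 4 * a`, `(t : ℤ) - 4 * a - 1`, `(t : ℤ) - 4 * a - 2`, `(t : ℤ) - 4 * a - 3`, `-(t : ℤ) + 4 * k
    + 4 * a + 6`, `-(t : ℤ) + 4 * k + 4 * a + 7`,
    `(t : ℤ) - 4 * k - 2` on the successive pieces). [cite: EntingJensen2009, §7.4.2,
    Fig. 7.10 (brickwork form of the honeycomb lattice)] -/
def s4cX (k a i j e g t : ℕ) : ℤ :=
  if t ≤ 2 * a + 1 then (t : ℤ)
  else if t ≤ 4 * a + 1 then -(t : ℤ) + 4 * a + 3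
  else if t ≤ 4 * a + 2 * i + 3 then (t : ℤ) - 4 * a
  else if t ≤ 4 * a + 2 * i + 2 * j + 5 then (t : ℤ) - 4 * a - 1
  else if t + 2 * e ≤ 2 * k + 4 * a + 2 then (t : ℤ) - 4 * a - 2
  else if t ≤ 2 * k + 4 * a + 4 then (t : ℤ) - 4 * a - 3
  else if t ≤ 2 * k + 4 * a + 2 * g + 6 then -(t : ℤ) + 4 * k + 4 * a + 6
  else if t ≤ 4 * k + 2 * a + 4 then -(t : ℤ) + 4 * k + 4 * a + 7
  else (t : ℤ) - 4 * k - 2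

/-- Height table of the s4c blocks: `0, −1, −2, −3, −4, −3, −2, −1, 0` on the 9 pieces. [cite: EntingJensen2009,
    §7.4.2, Fig. 7.10] -/
def s4cY (k a i j e g t : ℕ) : ℤ :=
  if t ≤ 2 * a + 1 then 0
  else if t ≤ 4 * a + 1 then -1
  else if t ≤ 4 * a + 2 * i + 3 then -2
  else if t ≤ 4 * a + 2 * i + 2 * j + 5 then -3
  else if t + 2 * e ≤ 2 * k + 4 * a + 2 then -4
  else if t ≤ 2 * k + 4 * a + 4 then -3
  else if t ≤ 2 * k + 4 * a + 2 * g + 6 then -2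
  else if t ≤ 4 * k + 2 * a + 4 then -1
  else 0

/-- **The A9 block** `(0,0)→…→(2a+1,0)↓←…←(2,−1)↓(2,−2)→…↓→…↓→…↑→…→(2k+1,−3)↑←…↑←…←(2a+3,−1)↑(2a+3,0)→…→(2k+2,0)` of
    length `6k+4`. [cite: EntingJensen2009, §7.4.2, Fig. 7.10] -/
def s4c (k a i j e g : ℕ) : ℕ → Site 2 := Tab.walk (6 * k + 4) (s4cX k a i j e g) (s4cY k a i j e g)

/-- The affine pieces of the tables of `s4c`, with their values. [cite: EntingJensen2009, §7.4.2, Fig. 7.10] -/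
private theorem s4c_cases (k a i j e g t : ℕ) :
    (t ≤ 2 * a + 1 ∧ s4cX k a i j e g t = (t : ℤ) ∧ s4cY k a i j e g t = 0) ∨
      (2 * a + 2 ≤ t ∧ t ≤ 4 * a + 1 ∧ s4cX k a i j e g t = -(t : ℤ) + 4 * a + 3 ∧ s4cY k a i j e g t = -1) ∨
      (4 * a + 2 ≤ t ∧ t ≤ 4 * a + 2 * i + 3 ∧ s4cX k a i j e g t = (t : ℤ) - 4 * a ∧ s4cY k a i j e g t = -2) ∨
      (4 * a + 2 * i + 4 ≤ t ∧ t ≤ 4 * a + 2 * i + 2 * j + 5 ∧ s4cX k a i j e g t = (t : ℤ) - 4 * a - 1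
          ∧ s4cY k a i j e g t = -3) ∨
      (4 * a + 2 * i + 2 * j + 6 ≤ t ∧ t + 2 * e ≤ 2 * k + 4 * a + 2 ∧ s4cX k a i j e g t = (t : ℤ) - 4 * a - 2
          ∧ s4cY k a i j e g t = -4) ∨
      (2 * k + 4 * a + 3 ≤ t + 2 * e ∧ t ≤ 2 * k + 4 * a + 4 ∧ s4cX k a i j e g t = (t : ℤ) - 4 * a - 3
          ∧ s4cY k a i j e g t = -3) ∨
      (2 * k + 4 * a + 5 ≤ t ∧ t ≤ 2 * k + 4 * a + 2 * g + 6 ∧ s4cX k a i j e g t = -(t : ℤ) + 4 * k + 4 * a + 6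
          ∧ s4cY k a i j e g t = -2) ∨
      (2 * k + 4 * a + 2 * g + 7 ≤ t ∧ t ≤ 4 * k + 2 * a + 4 ∧ s4cX k a i j e g t = -(t : ℤ) + 4 * k + 4 * a + 7
          ∧ s4cY k a i j e g t = -1) ∨
      (4 * k + 2 * a + 5 ≤ t ∧ s4cX k a i j e g t = (t : ℤ) - 4 * k - 2 ∧ s4cY k a i j e g t = 0) := by
  simp only [s4cX, s4cY]
  split_ifs
  · exact Or.inl ⟨by omega, by omega, by omega⟩
  · exact Or.inr (Or.inl ⟨by omega, by omega, by omega, by omega⟩)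
  · exact Or.inr (Or.inr (Or.inl ⟨by omega, by omega, by omega, by omega⟩))
  · exact Or.inr (Or.inr (Or.inr (Or.inl ⟨by omega, by omega, by omega, by omega⟩)))
  · exact Or.inr (Or.inr (Or.inr (Or.inr (Or.inl ⟨by omega, by omega, by omega, by omega⟩))))
  · exact Or.inr (Or.inr (Or.inr (Or.inr (Or.inr (Or.inl ⟨by omega, by omega, by omega, by omega⟩)))))
  · exact Or.inr (Or.inr (Or.inr (Or.inr (Or.inr (Or.inr (Or.inl ⟨by omega, by omega, by omega, by omega⟩))))))
  · exact Or.inr (Or.inr (Or.inr (Or.inr (Or.inr (Or.inr (Or.inr (Or.inl ⟨by omega, by omega, by omega, by omega⟩)))))))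
  · exact Or.inr (Or.inr (Or.inr (Or.inr (Or.inr (Or.inr (Or.inr (Or.inr (⟨by omega, by omega, by omega⟩))))))))

/-- **Coordinate facts of `s4c`** (`1 ≤ a`, `i + j + e + 3 ≤ k`, `i + g + 2 ≤ k`, `a + g + 2 ≤ k`): brick-wall steps,
    self-avoidance, lower half-plane, columns in
`[0, X_L]` and `≥ 1` after time `0`, start and end on the wall, even length. [cite: EntingJensen2009, §7.4.2, Fig. 7.10]
[cite: MadrasSlade1993, §1.2, Definition 1.2.4 (bridges, p. 11)] -/
theorem s4c_facts {k a i j e g : ℕ} (ha : 1 ≤ a) (hije : i + j + e + 3 ≤ k) (hgi : i + g + 2 ≤ k) (hga : a + g + 2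
    ≤ k) : Tab.Facts (6 * k + 4) (s4cX k a i j e g) (s4cY k a i j e g) := by
  refine ⟨fun t ht => ?_, fun t ht s hs hx hy => ?_, fun t ht => ?_, fun t ht => ?_, ?_, ?_, ?_, by omega,
      fun t ht h1 => ?_⟩
  · rw [adjE_iff_fd]
    rcases s4c_cases k a i j e g t with ⟨h, x, y⟩ | ⟨l, h, x, y⟩ | ⟨l, h, x, y⟩ | ⟨l, h, x, y⟩ | ⟨l, h, x, y⟩ | ⟨l,
        h, x, y⟩ | ⟨l, h, x, y⟩ | ⟨l, h, x, y⟩ | ⟨l, x, y⟩ <;>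
      rcases s4c_cases k a i j e g (t + 1) with ⟨h', x', y'⟩ | ⟨l', h', x', y'⟩ | ⟨l', h', x', y'⟩ | ⟨l', h', x',
          y'⟩ | ⟨l', h', x', y'⟩ | ⟨l', h', x', y'⟩ | ⟨l', h', x', y'⟩ | ⟨l', h', x', y'⟩ | ⟨l', x', y'⟩ <;>
        omega
  · rcases s4c_cases k a i j e g t with ⟨h, x, y⟩ | ⟨l, h, x, y⟩ | ⟨l, h, x, y⟩ | ⟨l, h, x, y⟩ | ⟨l, h, x, y⟩ | ⟨l,
      h, x, y⟩ | ⟨l, h, x, y⟩ | ⟨l, h, x, y⟩ | ⟨l, x, y⟩ <;>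
      rcases s4c_cases k a i j e g s with ⟨h', x', y'⟩ | ⟨l', h', x', y'⟩ | ⟨l', h', x', y'⟩ | ⟨l', h', x',
          y'⟩ | ⟨l', h', x', y'⟩ | ⟨l', h', x', y'⟩ | ⟨l', h', x', y'⟩ | ⟨l', h', x', y'⟩ | ⟨l', x', y'⟩ <;>
        omega
  · rcases s4c_cases k a i j e g t with ⟨h, x, y⟩ | ⟨l, h, x, y⟩ | ⟨l, h, x, y⟩ | ⟨l, h, x, y⟩ | ⟨l, h, x, y⟩ | ⟨l,
      h, x, y⟩ | ⟨l, h, x, y⟩ | ⟨l, h, x, y⟩ | ⟨l, x, y⟩ <;> omega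
  · have h0 := s4c_cases k a i j e g 0
    have hL := s4c_cases k a i j e g (6 * k + 4)
    rcases s4c_cases k a i j e g t with ⟨h, x, y⟩ | ⟨l, h, x, y⟩ | ⟨l, h, x, y⟩ | ⟨l, h, x, y⟩ | ⟨l, h, x, y⟩ | ⟨l,
        h, x, y⟩ | ⟨l, h, x, y⟩ | ⟨l, h, x, y⟩ | ⟨l, x, y⟩ <;> omega
  · have h0 := s4c_cases k a i j e g 0; omega
  · have h0 := s4c_cases k a i j e g 0; omega
  · have hL := s4c_cases k a i j e g (6 * k + 4); omega
  · rcases s4c_cases k a i j e g t with ⟨h, x, y⟩ | ⟨l, h, x, y⟩ | ⟨l, h, x, y⟩ | ⟨l, h, x, y⟩ | ⟨l, h, x, y⟩ | ⟨l,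
      h, x, y⟩ | ⟨l, h, x, y⟩ | ⟨l, h, x, y⟩ | ⟨l, x, y⟩ <;> omega

/-- `s4c` is a positive wall bridge of length `m = 6k + 4` (length symbolic). [cite: MadrasSlade1993, §1.2,
    Definition 1.2.4 (p. 11)]
[cite: EntingJensen2009, §7.4.2, Fig. 7.10] -/
theorem s4c_mem_pwb {k a i j e g m : ℕ} (ha : 1 ≤ a) (hije : i + j + e + 3 ≤ k) (hgi : i + g + 2 ≤ k) (hga : a + g
    + 2 ≤ k) (hm : m = 6 * k + 4) : s4c k a i j e g ∈ pwb m :=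
  mem_pwb_of_facts rfl (s4c_facts ha hije hgi hga) hm

/-- Coordinates of `s4c` up to its length. [cite: EntingJensen2009, §7.4.2, Fig. 7.10] -/
theorem s4c_apply {k a i j e g t : ℕ} (ht : t ≤ 6 * k + 4) : s4c k a i j e g t 0 = s4cX k a i j e g t
    ∧ s4c k a i j e g t 1 = s4cY k a i j e g t :=
  tab_walk_apply ht

/-- **`s4c` is irreducible**: the interior visits of the initial wall run are followed by the return to column `2`,
    those of the final wall run (columns `≤ 2k`) are preceded by the bottom exit column `2k+1` (row `−3`). [cite:
    MadrasSlade1993, §4.2, Definition 4.2.1 (p. 90)]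
[cite: Kesten1963SAW, §4] [cite: EntingJensen2009, §7.4.2, Fig. 7.10] -/
theorem s4c_mem_ipwb {k a i j e g m : ℕ} (ha : 1 ≤ a) (hije : i + j + e + 3 ≤ k) (hgi : i + g + 2 ≤ k) (hga : a + g
    + 2 ≤ k) (hm : m = 6 * k + 4) : s4c k a i j e g ∈ ipwb m := by
  refine mem_ipwb_of_facts_wit rfl (s4c_facts ha hije hgi hga) hm (by omega) fun t ht1 ht2 hte hY => ?_
  rcases s4c_cases k a i j e g t with ⟨h, x, y⟩ | ⟨l, h, x, y⟩ | ⟨l, h, x, y⟩ | ⟨l, h, x, y⟩ | ⟨l, h, x, y⟩ | ⟨l, h,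
      x, y⟩ | ⟨l, h, x, y⟩ | ⟨l, h, x, y⟩ | ⟨l, x, y⟩
  · refine Or.inl ⟨4 * a + 1, by omega, by omega, ?_⟩
    rcases s4c_cases k a i j e g (4 * a + 1) with ⟨h', x', y'⟩ | ⟨l', h', x', y'⟩ | ⟨l', h', x', y'⟩ | ⟨l', h', x',
        y'⟩ | ⟨l', h', x', y'⟩ | ⟨l', h', x', y'⟩ | ⟨l', h', x', y'⟩ | ⟨l', h', x', y'⟩ | ⟨l', x', y'⟩ <;>
      omega
  · omega
  · omega
  · omega
  · omega
  · omega
  · omega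
  · omega
  · refine Or.inr ⟨2 * k + 4 * a + 4, by omega, by omega, ?_⟩
    rcases s4c_cases k a i j e g (2 * k + 4 * a + 4) with ⟨h', x', y'⟩ | ⟨l', h', x', y'⟩ | ⟨l', h', x', y'⟩ | ⟨l',
        h', x', y'⟩ | ⟨l', h', x', y'⟩ | ⟨l', h', x', y'⟩ | ⟨l', h', x', y'⟩ | ⟨l', h', x', y'⟩ | ⟨l', x', y'⟩ <;>
      omega

/-- **`s4c` has `k` visits** (`a` on the initial wall run, `k − a` on the final one).
[cite: BeatonBousquetMelouDeGierDuminilCopinGuttmann2014, §3.1 (arXiv v5 p. 8)] [cite: EntingJensen2009, §7.4.2,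
    Fig. 7.10] -/
theorem visits_s4c {k a i j e g m : ℕ} (ha : 1 ≤ a) (hije : i + j + e + 3 ≤ k) (hgi : i + g + 2 ≤ k) (hga : a + g
    + 2 ≤ k) (hm : m = 6 * k + 4) : visits m (s4c k a i j e g) = k := by
  have hY : ∀ t, t ≤ 6 * k + 4 → s4c k a i j e g t 1 = s4cY k a i j e g t := fun t ht => (s4c_apply ht).2
  have h1 : visits (0 + (2 * a + 1)) (s4c k a i j e g) = visits (0) (s4c k a i j e g) + ((0 + (2 * a
      + 1)) / 2 - (0) / 2) :=
    visits_add_of_wall fun q _ hq => by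
      rw [hY _ (by omega)]
      rcases s4c_cases k a i j e g (0 + q) with ⟨h', x', y'⟩ | ⟨l', h', x', y'⟩ | ⟨l', h', x', y'⟩ | ⟨l', h', x',
          y'⟩ | ⟨l', h', x', y'⟩ | ⟨l', h', x', y'⟩ | ⟨l', h', x', y'⟩ | ⟨l', h', x', y'⟩ | ⟨l', x', y'⟩ <;>
        omega
  have h2 : visits (2 * a + 1 + (4 * k + 3)) (s4c k a i j e g) = visits (2 * a + 1) (s4c k a i j e g) :=
    visits_add_eq_left fun q hq1 hq2 h => by
      obtain ⟨-, h0⟩ := h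
      rw [hY _ (by omega)] at h0
      rcases s4c_cases k a i j e g (2 * a + 1 + q) with ⟨h', x', y'⟩ | ⟨l', h', x', y'⟩ | ⟨l', h', x', y'⟩ | ⟨l', h',
          x', y'⟩ | ⟨l', h', x', y'⟩ | ⟨l', h', x', y'⟩ | ⟨l', h', x', y'⟩ | ⟨l', h', x', y'⟩ | ⟨l', x', y'⟩ <;> omega
  have h3 : visits (4 * k + 2 * a + 4 + (2 * k - 2 * a)) (s4c k a i j e g) = visits (4 * k + 2 * a
      + 4) (s4c k a i j e g) + ((4 * k + 2 * a + 4 + (2 * k - 2 * a)) / 2 - (4 * k + 2 * a + 4) / 2) :=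
    visits_add_of_wall fun q _ hq => by
      rw [hY _ (by omega)]
      rcases s4c_cases k a i j e g (4 * k + 2 * a + 4 + q) with ⟨h', x', y'⟩ | ⟨l', h', x', y'⟩ | ⟨l', h', x',
          y'⟩ | ⟨l', h', x', y'⟩ | ⟨l', h', x', y'⟩ | ⟨l', h', x', y'⟩ | ⟨l', h', x', y'⟩ | ⟨l', h', x', y'⟩ | ⟨l',
          x', y'⟩ <;>
        omega
  rw [zero_add, visits_zero, zero_add] at h1
  rw [show 2 * a + 1 + (4 * k + 3) = 4 * k + 2 * a + 4 by omega, h1] at h2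
  rw [show 4 * k + 2 * a + 4 + (2 * k - 2 * a) = 6 * k + 4 by omega, h2] at h3
  subst hm
  rw [h3]
  omega

/-- **`s4c` has four down steps**, at the times `2 * a + 1`, `4 * a + 1`, `4 * a + 2 * i + 3`, `4 * a + 2 * i
    + 2 * j + 5`. [cite: EntingJensen2009, §7.4.2, Fig. 7.10] -/
theorem stepsD_s4c {k a i j e g m : ℕ} (ha : 1 ≤ a) (hije : i + j + e + 3 ≤ k) (hgi : i + g + 2 ≤ k) (hga : a + g
    + 2 ≤ k) (hm : m = 6 * k + 4) :
    stepsD m (s4c k a i j e g) = {2 * a + 1, 4 * a + 1, 4 * a + 2 * i + 3, 4 * a + 2 * i + 2 * j + 5} := by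
  subst hm
  ext t
  simp only [stepsD, mem_filter, mem_range, mem_insert, mem_singleton]
  constructor
  · rintro ⟨ht, hx, hy⟩
    rw [(s4c_apply (t := t + 1) (by omega)).1, (s4c_apply (t := t) (by omega)).1] at hx
    rw [(s4c_apply (t := t + 1) (by omega)).2, (s4c_apply (t := t) (by omega)).2] at hy
    rcases s4c_cases k a i j e g t with ⟨h, x, y⟩ | ⟨l, h, x, y⟩ | ⟨l, h, x, y⟩ | ⟨l, h, x, y⟩ | ⟨l, h, x, y⟩ | ⟨l,
        h, x, y⟩ | ⟨l, h, x, y⟩ | ⟨l, h, x, y⟩ | ⟨l, x, y⟩ <;>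
      rcases s4c_cases k a i j e g (t + 1) with ⟨h', x', y'⟩ | ⟨l', h', x', y'⟩ | ⟨l', h', x', y'⟩ | ⟨l', h', x',
          y'⟩ | ⟨l', h', x', y'⟩ | ⟨l', h', x', y'⟩ | ⟨l', h', x', y'⟩ | ⟨l', h', x', y'⟩ | ⟨l', x', y'⟩ <;>
        omega
  · intro ht
    have ht4 : t + 1 ≤ 6 * k + 4 := by omega
    refine ⟨by omega, ?_, ?_⟩
    · rw [(s4c_apply ht4).1, (s4c_apply (t := t) (by omega)).1]
      rcases s4c_cases k a i j e g t with ⟨h, x, y⟩ | ⟨l, h, x, y⟩ | ⟨l, h, x, y⟩ | ⟨l, h, x, y⟩ | ⟨l, h, x, y⟩ | ⟨l,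
          h, x, y⟩ | ⟨l, h, x, y⟩ | ⟨l, h, x, y⟩ | ⟨l, x, y⟩ <;>
        rcases s4c_cases k a i j e g (t + 1) with ⟨h', x', y'⟩ | ⟨l', h', x', y'⟩ | ⟨l', h', x', y'⟩ | ⟨l', h', x',
            y'⟩ | ⟨l', h', x', y'⟩ | ⟨l', h', x', y'⟩ | ⟨l', h', x', y'⟩ | ⟨l', h', x', y'⟩ | ⟨l', x', y'⟩ <;>
          omega
    · rw [(s4c_apply ht4).2, (s4c_apply (t := t) (by omega)).2]
      rcases s4c_cases k a i j e g t with ⟨h, x, y⟩ | ⟨l, h, x, y⟩ | ⟨l, h, x, y⟩ | ⟨l, h, x, y⟩ | ⟨l, h, x, y⟩ | ⟨l,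
          h, x, y⟩ | ⟨l, h, x, y⟩ | ⟨l, h, x, y⟩ | ⟨l, x, y⟩ <;>
        rcases s4c_cases k a i j e g (t + 1) with ⟨h', x', y'⟩ | ⟨l', h', x', y'⟩ | ⟨l', h', x', y'⟩ | ⟨l', h', x',
            y'⟩ | ⟨l', h', x', y'⟩ | ⟨l', h', x', y'⟩ | ⟨l', h', x', y'⟩ | ⟨l', h', x', y'⟩ | ⟨l', x', y'⟩ <;>
          omega

/-- **`s4c` has four up steps**, at the times `2 * k + 4 * a + 2 - 2 * e`, `2 * k + 4 * a + 4`, `2 * k + 4 * a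
    + 2 * g + 6`, `4 * k + 2 * a + 4`. [cite: EntingJensen2009, §7.4.2, Fig. 7.10] -/
theorem stepsU_s4c {k a i j e g m : ℕ} (ha : 1 ≤ a) (hije : i + j + e + 3 ≤ k) (hgi : i + g + 2 ≤ k) (hga : a + g
    + 2 ≤ k) (hm : m = 6 * k + 4) :
    stepsU m (s4c k a i j e g) = {2 * k + 4 * a + 2 - 2 * e, 2 * k + 4 * a + 4, 2 * k + 4 * a + 2 * g + 6, 4 * k
        + 2 * a + 4} := by
  subst hm
  ext t
  simp only [stepsU, mem_filter, mem_range, mem_insert, mem_singleton]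
  constructor
  · rintro ⟨ht, hx, hy⟩
    rw [(s4c_apply (t := t + 1) (by omega)).1, (s4c_apply (t := t) (by omega)).1] at hx
    rw [(s4c_apply (t := t + 1) (by omega)).2, (s4c_apply (t := t) (by omega)).2] at hy
    rcases s4c_cases k a i j e g t with ⟨h, x, y⟩ | ⟨l, h, x, y⟩ | ⟨l, h, x, y⟩ | ⟨l, h, x, y⟩ | ⟨l, h, x, y⟩ | ⟨l,
        h, x, y⟩ | ⟨l, h, x, y⟩ | ⟨l, h, x, y⟩ | ⟨l, x, y⟩ <;>
      rcases s4c_cases k a i j e g (t + 1) with ⟨h', x', y'⟩ | ⟨l', h', x', y'⟩ | ⟨l', h', x', y'⟩ | ⟨l', h', x',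
          y'⟩ | ⟨l', h', x', y'⟩ | ⟨l', h', x', y'⟩ | ⟨l', h', x', y'⟩ | ⟨l', h', x', y'⟩ | ⟨l', x', y'⟩ <;>
        omega
  · intro ht
    have ht4 : t + 1 ≤ 6 * k + 4 := by omega
    refine ⟨by omega, ?_, ?_⟩
    · rw [(s4c_apply ht4).1, (s4c_apply (t := t) (by omega)).1]
      rcases s4c_cases k a i j e g t with ⟨h, x, y⟩ | ⟨l, h, x, y⟩ | ⟨l, h, x, y⟩ | ⟨l, h, x, y⟩ | ⟨l, h, x, y⟩ | ⟨l,
          h, x, y⟩ | ⟨l, h, x, y⟩ | ⟨l, h, x, y⟩ | ⟨l, x, y⟩ <;>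
        rcases s4c_cases k a i j e g (t + 1) with ⟨h', x', y'⟩ | ⟨l', h', x', y'⟩ | ⟨l', h', x', y'⟩ | ⟨l', h', x',
            y'⟩ | ⟨l', h', x', y'⟩ | ⟨l', h', x', y'⟩ | ⟨l', h', x', y'⟩ | ⟨l', h', x', y'⟩ | ⟨l', x', y'⟩ <;>
          omega
    · rw [(s4c_apply ht4).2, (s4c_apply (t := t) (by omega)).2]
      rcases s4c_cases k a i j e g t with ⟨h, x, y⟩ | ⟨l, h, x, y⟩ | ⟨l, h, x, y⟩ | ⟨l, h, x, y⟩ | ⟨l, h, x, y⟩ | ⟨l,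
          h, x, y⟩ | ⟨l, h, x, y⟩ | ⟨l, h, x, y⟩ | ⟨l, x, y⟩ <;>
        rcases s4c_cases k a i j e g (t + 1) with ⟨h', x', y'⟩ | ⟨l', h', x', y'⟩ | ⟨l', h', x', y'⟩ | ⟨l', h', x',
            y'⟩ | ⟨l', h', x', y'⟩ | ⟨l', h', x', y'⟩ | ⟨l', h', x', y'⟩ | ⟨l', h', x', y'⟩ | ⟨l', x', y'⟩ <;>
          omega


/-! ### §4  Family A10 (`D D D D U U U U`, wall run of length `2k−1`, hairpin,
    staircases down and up): `R^{2k−1} D L^{2k−3} D R^{2i+1} D R^{2j+1} D R^{2k−2i−2j−2e−2g−6} U R^{2e+1} U R^{2g+1}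
    U R U R` -/

/-- Column table of the s4d blocks (length `6k + 4`, vertical profile `D D D D U U U U`),
    9 affine pieces on the rows `0, −1, −2, −3, −4, −3, −2, −1, 0` (values `(t : ℤ)`, `-(t : ℤ) + 4 * k - 1`,
    `(t : ℤ) - 4 * k + 4`, `(t : ℤ) - 4 * k + 3`, `(t : ℤ) - 4 * k + 2`, `(t : ℤ) - 4 * k + 1`, `(t : ℤ) - 4 * k`,
    `(t : ℤ) - 4 * k - 1`, `(t : ℤ) - 4 * k - 2` on the successive pieces). [cite: EntingJensen2009, §7.4.2,
    Fig. 7.10 (brickwork form of the honeycomb lattice)] -/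
def s4dX (k i j e g t : ℕ) : ℤ :=
  if t + 1 ≤ 2 * k then (t : ℤ)
  else if t + 3 ≤ 4 * k then -(t : ℤ) + 4 * k - 1
  else if t + 1 ≤ 4 * k + 2 * i then (t : ℤ) - 4 * k + 4
  else if t ≤ 4 * k + 2 * i + 2 * j + 1 then (t : ℤ) - 4 * k + 3
  else if t + 2 * e + 2 * g + 4 ≤ 6 * k then (t : ℤ) - 4 * k + 2
  else if t + 2 * g + 2 ≤ 6 * k then (t : ℤ) - 4 * k + 1
  else if t ≤ 6 * k then (t : ℤ) - 4 * k
  else if t ≤ 6 * k + 2 then (t : ℤ) - 4 * k - 1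
  else (t : ℤ) - 4 * k - 2

/-- Height table of the s4d blocks: `0, −1, −2, −3, −4, −3, −2, −1, 0` on the 9 pieces. [cite: EntingJensen2009,
    §7.4.2, Fig. 7.10] -/
def s4dY (k i j e g t : ℕ) : ℤ :=
  if t + 1 ≤ 2 * k then 0
  else if t + 3 ≤ 4 * k then -1
  else if t + 1 ≤ 4 * k + 2 * i then -2
  else if t ≤ 4 * k + 2 * i + 2 * j + 1 then -3
  else if t + 2 * e + 2 * g + 4 ≤ 6 * k then -4
  else if t + 2 * g + 2 ≤ 6 * k then -3
  else if t ≤ 6 * k then -2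
  else if t ≤ 6 * k + 2 then -1
  else 0

/-- **The A10 block** `(0,0)→…→(2k−1,0)↓←…←(2,−1)↓(2,−2)→…↓→…↓→…↑→…↑→…→(2k,−2)↑(2k,−1)→(2k+1,−1)↑(2k+1,0)→(2k+2,0)`
    of length `6k+4`. [cite: EntingJensen2009, §7.4.2, Fig. 7.10] -/
def s4d (k i j e g : ℕ) : ℕ → Site 2 := Tab.walk (6 * k + 4) (s4dX k i j e g) (s4dY k i j e g)

/-- The affine pieces of the tables of `s4d`, with their values. [cite: EntingJensen2009, §7.4.2, Fig. 7.10] -/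
private theorem s4d_cases (k i j e g t : ℕ) :
    (t + 1 ≤ 2 * k ∧ s4dX k i j e g t = (t : ℤ) ∧ s4dY k i j e g t = 0) ∨
      (2 * k ≤ t ∧ t + 3 ≤ 4 * k ∧ s4dX k i j e g t = -(t : ℤ) + 4 * k - 1 ∧ s4dY k i j e g t = -1) ∨
      (4 * k ≤ t + 2 ∧ t + 1 ≤ 4 * k + 2 * i ∧ s4dX k i j e g t = (t : ℤ) - 4 * k + 4 ∧ s4dY k i j e g t = -2) ∨
      (4 * k + 2 * i ≤ t ∧ t ≤ 4 * k + 2 * i + 2 * j + 1 ∧ s4dX k i j e g t = (t : ℤ) - 4 * k + 3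
          ∧ s4dY k i j e g t = -3) ∨
      (4 * k + 2 * i + 2 * j + 2 ≤ t ∧ t + 2 * e + 2 * g + 4 ≤ 6 * k ∧ s4dX k i j e g t = (t : ℤ) - 4 * k + 2
          ∧ s4dY k i j e g t = -4) ∨
      (6 * k ≤ t + 2 * e + 2 * g + 3 ∧ t + 2 * g + 2 ≤ 6 * k ∧ s4dX k i j e g t = (t : ℤ) - 4 * k + 1
          ∧ s4dY k i j e g t = -3) ∨
      (6 * k ≤ t + 2 * g + 1 ∧ t ≤ 6 * k ∧ s4dX k i j e g t = (t : ℤ) - 4 * k ∧ s4dY k i j e g t = -2) ∨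
      (6 * k + 1 ≤ t ∧ t ≤ 6 * k + 2 ∧ s4dX k i j e g t = (t : ℤ) - 4 * k - 1 ∧ s4dY k i j e g t = -1) ∨
      (6 * k + 3 ≤ t ∧ s4dX k i j e g t = (t : ℤ) - 4 * k - 2 ∧ s4dY k i j e g t = 0) := by
  simp only [s4dX, s4dY]
  split_ifs
  · exact Or.inl ⟨by omega, by omega, by omega⟩
  · exact Or.inr (Or.inl ⟨by omega, by omega, by omega, by omega⟩)
  · exact Or.inr (Or.inr (Or.inl ⟨by omega, by omega, by omega, by omega⟩))
  · exact Or.inr (Or.inr (Or.inr (Or.inl ⟨by omega, by omega, by omega, by omega⟩)))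
  · exact Or.inr (Or.inr (Or.inr (Or.inr (Or.inl ⟨by omega, by omega, by omega, by omega⟩))))
  · exact Or.inr (Or.inr (Or.inr (Or.inr (Or.inr (Or.inl ⟨by omega, by omega, by omega, by omega⟩)))))
  · exact Or.inr (Or.inr (Or.inr (Or.inr (Or.inr (Or.inr (Or.inl ⟨by omega, by omega, by omega, by omega⟩))))))
  · exact Or.inr (Or.inr (Or.inr (Or.inr (Or.inr (Or.inr (Or.inr (Or.inl ⟨by omega, by omega, by omega, by omega⟩)))))))
  · exact Or.inr (Or.inr (Or.inr (Or.inr (Or.inr (Or.inr (Or.inr (Or.inr (⟨by omega, by omega, by omega⟩))))))))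

/-- **Coordinate facts of `s4d`** (`i + j + e + g + 4 ≤ k`): brick-wall steps, self-avoidance, lower half-plane,
    columns in
`[0, X_L]` and `≥ 1` after time `0`, start and end on the wall, even length. [cite: EntingJensen2009, §7.4.2, Fig. 7.10]
[cite: MadrasSlade1993, §1.2, Definition 1.2.4 (bridges, p. 11)] -/
theorem s4d_facts {k i j e g : ℕ} (hs : i + j + e + g + 4 ≤ k) : Tab.Facts (6 * k
    + 4) (s4dX k i j e g) (s4dY k i j e g) := by
  refine ⟨fun t ht => ?_, fun t ht s hs hx hy => ?_, fun t ht => ?_, fun t ht => ?_, ?_, ?_, ?_, by omega,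
      fun t ht h1 => ?_⟩
  · rw [adjE_iff_fd]
    rcases s4d_cases k i j e g t with ⟨h, x, y⟩ | ⟨l, h, x, y⟩ | ⟨l, h, x, y⟩ | ⟨l, h, x, y⟩ | ⟨l, h, x, y⟩ | ⟨l, h,
        x, y⟩ | ⟨l, h, x, y⟩ | ⟨l, h, x, y⟩ | ⟨l, x, y⟩ <;>
      rcases s4d_cases k i j e g (t + 1) with ⟨h', x', y'⟩ | ⟨l', h', x', y'⟩ | ⟨l', h', x', y'⟩ | ⟨l', h', x',
          y'⟩ | ⟨l', h', x', y'⟩ | ⟨l', h', x', y'⟩ | ⟨l', h', x', y'⟩ | ⟨l', h', x', y'⟩ | ⟨l', x', y'⟩ <;>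
        omega
  · rcases s4d_cases k i j e g t with ⟨h, x, y⟩ | ⟨l, h, x, y⟩ | ⟨l, h, x, y⟩ | ⟨l, h, x, y⟩ | ⟨l, h, x, y⟩ | ⟨l, h,
      x, y⟩ | ⟨l, h, x, y⟩ | ⟨l, h, x, y⟩ | ⟨l, x, y⟩ <;>
      rcases s4d_cases k i j e g s with ⟨h', x', y'⟩ | ⟨l', h', x', y'⟩ | ⟨l', h', x', y'⟩ | ⟨l', h', x', y'⟩ | ⟨l',
          h', x', y'⟩ | ⟨l', h', x', y'⟩ | ⟨l', h', x', y'⟩ | ⟨l', h', x', y'⟩ | ⟨l', x', y'⟩ <;>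
        omega
  · rcases s4d_cases k i j e g t with ⟨h, x, y⟩ | ⟨l, h, x, y⟩ | ⟨l, h, x, y⟩ | ⟨l, h, x, y⟩ | ⟨l, h, x, y⟩ | ⟨l, h,
      x, y⟩ | ⟨l, h, x, y⟩ | ⟨l, h, x, y⟩ | ⟨l, x, y⟩ <;> omega
  · have h0 := s4d_cases k i j e g 0
    have hL := s4d_cases k i j e g (6 * k + 4)
    rcases s4d_cases k i j e g t with ⟨h, x, y⟩ | ⟨l, h, x, y⟩ | ⟨l, h, x, y⟩ | ⟨l, h, x, y⟩ | ⟨l, h, x, y⟩ | ⟨l, h,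
        x, y⟩ | ⟨l, h, x, y⟩ | ⟨l, h, x, y⟩ | ⟨l, x, y⟩ <;> omega
  · have h0 := s4d_cases k i j e g 0; omega
  · have h0 := s4d_cases k i j e g 0; omega
  · have hL := s4d_cases k i j e g (6 * k + 4); omega
  · rcases s4d_cases k i j e g t with ⟨h, x, y⟩ | ⟨l, h, x, y⟩ | ⟨l, h, x, y⟩ | ⟨l, h, x, y⟩ | ⟨l, h, x, y⟩ | ⟨l, h,
      x, y⟩ | ⟨l, h, x, y⟩ | ⟨l, h, x, y⟩ | ⟨l, x, y⟩ <;> omega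

/-- `s4d` is a positive wall bridge of length `m = 6k + 4` (length symbolic). [cite: MadrasSlade1993, §1.2,
    Definition 1.2.4 (p. 11)]
[cite: EntingJensen2009, §7.4.2, Fig. 7.10] -/
theorem s4d_mem_pwb {k i j e g m : ℕ} (hs : i + j + e + g + 4 ≤ k) (hm : m = 6 * k + 4) : s4d k i j e g ∈ pwb m :=
  mem_pwb_of_facts rfl (s4d_facts hs) hm

/-- Coordinates of `s4d` up to its length. [cite: EntingJensen2009, §7.4.2, Fig. 7.10] -/
theorem s4d_apply {k i j e g t : ℕ} (ht : t ≤ 6 * k + 4) : s4d k i j e g t 0 = s4dX k i j e g t ∧ s4d k i j e g t 1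
    = s4dY k i j e g t :=
  tab_walk_apply ht

/-- **`s4d` is irreducible**: the interior visits (all on the initial wall run) are followed by the return to column
    `2`; the final wall run is a single step. [cite: MadrasSlade1993, §4.2, Definition 4.2.1 (p. 90)]
[cite: Kesten1963SAW, §4] [cite: EntingJensen2009, §7.4.2, Fig. 7.10] -/
theorem s4d_mem_ipwb {k i j e g m : ℕ} (hs : i + j + e + g + 4 ≤ k) (hm : m = 6 * k + 4) : s4d k i j e g ∈ ipwb m := by
  refine mem_ipwb_of_facts_wit rfl (s4d_facts hs) hm (by omega) fun t ht1 ht2 hte hY => ?_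
  rcases s4d_cases k i j e g t with ⟨h, x, y⟩ | ⟨l, h, x, y⟩ | ⟨l, h, x, y⟩ | ⟨l, h, x, y⟩ | ⟨l, h, x, y⟩ | ⟨l, h, x,
      y⟩ | ⟨l, h, x, y⟩ | ⟨l, h, x, y⟩ | ⟨l, x, y⟩
  · refine Or.inl ⟨4 * k - 3, by omega, by omega, ?_⟩
    rcases s4d_cases k i j e g (4 * k - 3) with ⟨h', x', y'⟩ | ⟨l', h', x', y'⟩ | ⟨l', h', x', y'⟩ | ⟨l', h', x',
        y'⟩ | ⟨l', h', x', y'⟩ | ⟨l', h', x', y'⟩ | ⟨l', h', x', y'⟩ | ⟨l', h', x', y'⟩ | ⟨l', x', y'⟩ <;>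
      omega
  · omega
  · omega
  · omega
  · omega
  · omega
  · omega
  · omega
  · omega

/-- **`s4d` has `k` visits** (`k − 1` on the initial wall run and the endpoint).
[cite: BeatonBousquetMelouDeGierDuminilCopinGuttmann2014, §3.1 (arXiv v5 p. 8)] [cite: EntingJensen2009, §7.4.2,
    Fig. 7.10] -/
theorem visits_s4d {k i j e g m : ℕ} (hs : i + j + e + g + 4 ≤ k) (hm : m = 6 * k + 4) : visits m (s4d k i j e g)
    = k := by
  have hY : ∀ t, t ≤ 6 * k + 4 → s4d k i j e g t 1 = s4dY k i j e g t := fun t ht => (s4d_apply ht).2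
  have h1 : visits (0 + (2 * k - 1)) (s4d k i j e g) = visits (0) (s4d k i j e g) + ((0 + (2 * k - 1)) / 2 - (0) / 2) :=
    visits_add_of_wall fun q _ hq => by
      rw [hY _ (by omega)]
      rcases s4d_cases k i j e g (0 + q) with ⟨h', x', y'⟩ | ⟨l', h', x', y'⟩ | ⟨l', h', x', y'⟩ | ⟨l', h', x',
          y'⟩ | ⟨l', h', x', y'⟩ | ⟨l', h', x', y'⟩ | ⟨l', h', x', y'⟩ | ⟨l', h', x', y'⟩ | ⟨l', x', y'⟩ <;>
        omega
  have h2 : visits (2 * k - 1 + (4 * k + 3)) (s4d k i j e g) = visits (2 * k - 1) (s4d k i j e g) :=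
    visits_add_eq_left fun q hq1 hq2 h => by
      obtain ⟨-, h0⟩ := h
      rw [hY _ (by omega)] at h0
      rcases s4d_cases k i j e g (2 * k - 1 + q) with ⟨h', x', y'⟩ | ⟨l', h', x', y'⟩ | ⟨l', h', x', y'⟩ | ⟨l', h',
          x', y'⟩ | ⟨l', h', x', y'⟩ | ⟨l', h', x', y'⟩ | ⟨l', h', x', y'⟩ | ⟨l', h', x', y'⟩ | ⟨l', x', y'⟩ <;> omega
  have h3 : visits (6 * k + 2 + (2)) (s4d k i j e g) = visits (6 * k + 2) (s4d k i j e g) + ((6 * k + 2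
      + (2)) / 2 - (6 * k + 2) / 2) :=
    visits_add_of_wall fun q _ hq => by
      rw [hY _ (by omega)]
      rcases s4d_cases k i j e g (6 * k + 2 + q) with ⟨h', x', y'⟩ | ⟨l', h', x', y'⟩ | ⟨l', h', x', y'⟩ | ⟨l', h',
          x', y'⟩ | ⟨l', h', x', y'⟩ | ⟨l', h', x', y'⟩ | ⟨l', h', x', y'⟩ | ⟨l', h', x', y'⟩ | ⟨l', x', y'⟩ <;>
        omega
  rw [zero_add, visits_zero, zero_add] at h1
  rw [show 2 * k - 1 + (4 * k + 3) = 6 * k + 2 by omega, h1] at h2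
  rw [show 6 * k + 2 + (2) = 6 * k + 4 by omega, h2] at h3
  subst hm
  rw [h3]
  omega

/-- **`s4d` has four down steps**, at the times `2 * k - 1`, `4 * k - 3`, `4 * k + 2 * i - 1`, `4 * k + 2 * i
    + 2 * j + 1`. [cite: EntingJensen2009, §7.4.2, Fig. 7.10] -/
theorem stepsD_s4d {k i j e g m : ℕ} (hs : i + j + e + g + 4 ≤ k) (hm : m = 6 * k + 4) :
    stepsD m (s4d k i j e g) = {2 * k - 1, 4 * k - 3, 4 * k + 2 * i - 1, 4 * k + 2 * i + 2 * j + 1} := by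
  subst hm
  ext t
  simp only [stepsD, mem_filter, mem_range, mem_insert, mem_singleton]
  constructor
  · rintro ⟨ht, hx, hy⟩
    rw [(s4d_apply (t := t + 1) (by omega)).1, (s4d_apply (t := t) (by omega)).1] at hx
    rw [(s4d_apply (t := t + 1) (by omega)).2, (s4d_apply (t := t) (by omega)).2] at hy
    rcases s4d_cases k i j e g t with ⟨h, x, y⟩ | ⟨l, h, x, y⟩ | ⟨l, h, x, y⟩ | ⟨l, h, x, y⟩ | ⟨l, h, x, y⟩ | ⟨l, h,
        x, y⟩ | ⟨l, h, x, y⟩ | ⟨l, h, x, y⟩ | ⟨l, x, y⟩ <;>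
      rcases s4d_cases k i j e g (t + 1) with ⟨h', x', y'⟩ | ⟨l', h', x', y'⟩ | ⟨l', h', x', y'⟩ | ⟨l', h', x',
          y'⟩ | ⟨l', h', x', y'⟩ | ⟨l', h', x', y'⟩ | ⟨l', h', x', y'⟩ | ⟨l', h', x', y'⟩ | ⟨l', x', y'⟩ <;>
        omega
  · intro ht
    have ht4 : t + 1 ≤ 6 * k + 4 := by omega
    refine ⟨by omega, ?_, ?_⟩
    · rw [(s4d_apply ht4).1, (s4d_apply (t := t) (by omega)).1]
      rcases s4d_cases k i j e g t with ⟨h, x, y⟩ | ⟨l, h, x, y⟩ | ⟨l, h, x, y⟩ | ⟨l, h, x, y⟩ | ⟨l, h, x, y⟩ | ⟨l,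
          h, x, y⟩ | ⟨l, h, x, y⟩ | ⟨l, h, x, y⟩ | ⟨l, x, y⟩ <;>
        rcases s4d_cases k i j e g (t + 1) with ⟨h', x', y'⟩ | ⟨l', h', x', y'⟩ | ⟨l', h', x', y'⟩ | ⟨l', h', x',
            y'⟩ | ⟨l', h', x', y'⟩ | ⟨l', h', x', y'⟩ | ⟨l', h', x', y'⟩ | ⟨l', h', x', y'⟩ | ⟨l', x', y'⟩ <;>
          omega
    · rw [(s4d_apply ht4).2, (s4d_apply (t := t) (by omega)).2]
      rcases s4d_cases k i j e g t with ⟨h, x, y⟩ | ⟨l, h, x, y⟩ | ⟨l, h, x, y⟩ | ⟨l, h, x, y⟩ | ⟨l, h, x, y⟩ | ⟨l,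
          h, x, y⟩ | ⟨l, h, x, y⟩ | ⟨l, h, x, y⟩ | ⟨l, x, y⟩ <;>
        rcases s4d_cases k i j e g (t + 1) with ⟨h', x', y'⟩ | ⟨l', h', x', y'⟩ | ⟨l', h', x', y'⟩ | ⟨l', h', x',
            y'⟩ | ⟨l', h', x', y'⟩ | ⟨l', h', x', y'⟩ | ⟨l', h', x', y'⟩ | ⟨l', h', x', y'⟩ | ⟨l', x', y'⟩ <;>
          omega

/-- **`s4d` has four up steps**, at the times `6 * k - 2 * e - 2 * g - 4`, `6 * k - 2 * g - 2`, `6 * k`, `6 * k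
    + 2`. [cite: EntingJensen2009, §7.4.2, Fig. 7.10] -/
theorem stepsU_s4d {k i j e g m : ℕ} (hs : i + j + e + g + 4 ≤ k) (hm : m = 6 * k + 4) :
    stepsU m (s4d k i j e g) = {6 * k - 2 * e - 2 * g - 4, 6 * k - 2 * g - 2, 6 * k, 6 * k + 2} := by
  subst hm
  ext t
  simp only [stepsU, mem_filter, mem_range, mem_insert, mem_singleton]
  constructor
  · rintro ⟨ht, hx, hy⟩
    rw [(s4d_apply (t := t + 1) (by omega)).1, (s4d_apply (t := t) (by omega)).1] at hx
    rw [(s4d_apply (t := t + 1) (by omega)).2, (s4d_apply (t := t) (by omega)).2] at hy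
    rcases s4d_cases k i j e g t with ⟨h, x, y⟩ | ⟨l, h, x, y⟩ | ⟨l, h, x, y⟩ | ⟨l, h, x, y⟩ | ⟨l, h, x, y⟩ | ⟨l, h,
        x, y⟩ | ⟨l, h, x, y⟩ | ⟨l, h, x, y⟩ | ⟨l, x, y⟩ <;>
      rcases s4d_cases k i j e g (t + 1) with ⟨h', x', y'⟩ | ⟨l', h', x', y'⟩ | ⟨l', h', x', y'⟩ | ⟨l', h', x',
          y'⟩ | ⟨l', h', x', y'⟩ | ⟨l', h', x', y'⟩ | ⟨l', h', x', y'⟩ | ⟨l', h', x', y'⟩ | ⟨l', x', y'⟩ <;>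
        omega
  · intro ht
    have ht4 : t + 1 ≤ 6 * k + 4 := by omega
    refine ⟨by omega, ?_, ?_⟩
    · rw [(s4d_apply ht4).1, (s4d_apply (t := t) (by omega)).1]
      rcases s4d_cases k i j e g t with ⟨h, x, y⟩ | ⟨l, h, x, y⟩ | ⟨l, h, x, y⟩ | ⟨l, h, x, y⟩ | ⟨l, h, x, y⟩ | ⟨l,
          h, x, y⟩ | ⟨l, h, x, y⟩ | ⟨l, h, x, y⟩ | ⟨l, x, y⟩ <;>
        rcases s4d_cases k i j e g (t + 1) with ⟨h', x', y'⟩ | ⟨l', h', x', y'⟩ | ⟨l', h', x', y'⟩ | ⟨l', h', x',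
            y'⟩ | ⟨l', h', x', y'⟩ | ⟨l', h', x', y'⟩ | ⟨l', h', x', y'⟩ | ⟨l', h', x', y'⟩ | ⟨l', x', y'⟩ <;>
          omega
    · rw [(s4d_apply ht4).2, (s4d_apply (t := t) (by omega)).2]
      rcases s4d_cases k i j e g t with ⟨h, x, y⟩ | ⟨l, h, x, y⟩ | ⟨l, h, x, y⟩ | ⟨l, h, x, y⟩ | ⟨l, h, x, y⟩ | ⟨l,
          h, x, y⟩ | ⟨l, h, x, y⟩ | ⟨l, h, x, y⟩ | ⟨l, x, y⟩ <;>
        rcases s4d_cases k i j e g (t + 1) with ⟨h', x', y'⟩ | ⟨l', h', x', y'⟩ | ⟨l', h', x', y'⟩ | ⟨l', h', x',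
            y'⟩ | ⟨l', h', x', y'⟩ | ⟨l', h', x', y'⟩ | ⟨l', h', x', y'⟩ | ⟨l', h', x', y'⟩ | ⟨l', x', y'⟩ <;>
          omega


end Literature.Probability.RandomPlanarGeometry.SAW.HexBW.Wall
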